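import Literature.MathematicalPhysics.QuantumFieldTheory.Balaban1983to89.B15Prop1ClosedGuardUniformRadius
import Literature.MathematicalPhysics.QuantumFieldTheory.Balaban1983to89.B15Prop1CoerciveOfFun

/-!
# `Balaban1983to89.B15Prop1CoerciveEdition` — [Balaban1989LargeFieldI] Prop. 1 p. 194 ∕ [Balaban1989LargeFieldII] pp. 357–359, (1.9):
# THE N12∕s1 RECORD-LEVEL ENDPOINT CHAIN RE-ISSUED WITH THE (1.9) COERCIVITY OF THE SLICE HESSIAN AS THE LETTER (`hcoer`) — the «`_ofCoercive` edition»,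
# upper half: the `Z`-sequence ∕ guarded-[15] ∕ torus-class ∕ value-matched layers, the (J0′) minimiser-family layer, and the compact-uniform layers

Honest framing: statement-level skeleton of published theorems with citation tags; proofs where landed; nothing here is a claim about the Yang–Mills mass gap.

Cell pub-ymgap, HUMAN RULINGS D-0062 ∕ D-0149 ∕ D-0154, width seat `pub-ymgap-dag-n12-w5` (g4) on node N12 = [B15], typing the lane owner's recipe (1)
(dag-n12-c g17 HANDOFF «SUCCESSOR'S TOP ITEM: THE COERCIVITY ROAD (β′)»; GO by dag-n12-c g18, pub-ymgap INBOX 2026-08-28T09:38:13Z).  Companion of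
`B15Prop1CoerciveOfFun` (the root and the `ofFun` layers), imported.

WHY.  See `B15Prop1CoerciveOfFun`: at the record the one-sided (1.7) curl letter `h17` is produced only at a gauge-NORMALISED base field, and the passage back to the
raw base field is a linear isometry of the slice coordinates under which (1.9) — not (1.7) — is invariant (dag-n12-w6 `B15Prop1DatumGaugeNormalisation` §8
`sliceCoercive_fun177std_bgMSCoPOfRecord_gaugeAct_iff`).  So every record-level endpoint is re-issued with the (1.9) letter
`hcoer : ∀ i V_k, PlaqSmallOn (plaqsInside (pts (k i) (Z i ∩ (Λ i)ᶜ))) (eR i) V_k → ∀ X, γ∕(M i)⁵·‖X‖² ≤ ⟪X, D(∇ sliceFn_i (fun177std (bgMSCoPOfRecord …) …) (ext i V_k))(0) X⟫`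
— term for term the `W := ext i V_k`, `γ := γ∕(M i)⁵` side of that iff — in place of `{γ₀} (hγ₀) (h17) (hsm) (hγle)`, the idle `(K) (hK1) (hKn)` ∕ `Cerr` dropped,
EVERYTHING ELSE VERBATIM (same binder order; the letter sits where `h17 hsm hγle` sat).  The lane owner's junction (recipe (2), dag-n12-c g18
`B15Prop1CoerciveAtNormalisedDatum`) produces `hcoer` from J-C v1.2's near-flat package at the normalised datum and keys on §3's
`…_ofMinimiserFamilyCompact_ofCoercive` BY NAME; dag-n12-d's 12Q⁹ keys on the same.

WHAT THIS FILE PROVES (no `sorry`, no definition; axioms standard).  Twins, with the surgery above and the source proofs (each calls the `_ofCoercive` layer below it):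
§1 `exists_domain_prop1Printed_lfVarOn_std_su2_box_intrinsic_analytic_atZSeqCoPRecord_ofNearValue_ofCoercive`, `…_atZSeqCoPRecord_ofThm1Guarded_ofCoercive`,
   `…_atZSeqCoPRecord_ofThm1TorusClass_ofCoercive`, `…_atZSeqCoPRecord_ofThm1TorusClass_ofValueMatched_ofCoercive` (twins of `B15Prop1OneSidedIneq17Edition` §3);
§2 `…_atZSeqCoPRecord_ofThm1TorusClass_ofMinimiserFamily_ofCoercive` (twin of dag-n12-w1's `B15Prop1JointHolomorphyFromMinimiserFamilyOneSided`);
§3 ★★★ `…_atZSeqCoPRecord_ofThm1TorusClass_ofMinimiserFamilyUniform_ofCoercive`, ★★★ `…_atZSeqCoPRecord_ofThm1TorusClass_ofMinimiserFamilyCompact_ofCoercive`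
   (twins of `B15Prop1ClosedGuardUniformRadius` §3 ∕ §4 one-sided; `[Finite ι]`, `R` produced, `cJ` absorbed; the private finite-max bookkeeping re-derived).

HONEST SCOPE.  Binder surgery only: nothing of Bałaban asserted; (1.9), (J0′)∕(J0ᵛ)∕(J1), the [15] letter remain LETTERS; each `_ofCoercive` endpoint is implied by its
`_oneSided` twin's hypotheses through `B15Prop1OneSidedIneq17OfFun.hessian_coercive_of_h17`; count-neutral; NOT a discharge of N12; K1 NOT closed; one finite
four-torus programme at fixed `ε = L^{-K}` — nothing continuum ∕ ℝ⁴ ∕ OS ∕ mass-gap ∕ Clay.  No `def`, no `instance`, no `sorry`.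

## References
* [Balaban1989LargeFieldI] T. Bałaban, Commun. Math. Phys. 122 (1989) 175–202, (1.74) p. 192, p. 193, Prop. 1 (1.77)–(1.78) p. 194, (1.79) p. 195.
* [Balaban1989LargeFieldII] T. Bałaban, Commun. Math. Phys. 122 (1989) 355–392, p. 357, (1.7)–(1.9) p. 358, (1.11)–(1.13) p. 359.
* [Balaban1985Variational] T. Bałaban, Commun. Math. Phys. 102 (1985) 277–309, (1) p. 277, (7) p. 278, Thm 1 (8) p. 279, Prop. 9 (190) p. 309.
* [Balaban1988Convergent] T. Bałaban, Commun. Math. Phys. 119 (1988) 243–285, (2.1) p. 254, (2.12)–(2.14) pp. 256–257, (2.16)–(2.18) p. 257.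
-/

noncomputable section

open Set Finset Metric
open scoped BigOperators Matrix RealInnerProductSpace Real InnerProductSpace

namespace Literature.MathematicalPhysics.QuantumFieldTheory.Balaban1983to89.B15Prop1CoerciveEdition

open B15DeterminingSets GaugeField B16Sect1Backgrounds B15Prop1Carrier B8Eq17ClassAkV1 BlockAveraging
open B15Prop1SliceTaylorCalculus B15Prop1IntrinsicAnalyticExt B15Prop1ParametricZeroBranch B15Prop1LocalLettersOfFun B15Prop1IntrinsicOfFun
open B15Prop1IntrinsicOfRecord B15Prop1GradientFromNearValue B15Prop1GradientFromNearValueAtCoPRecord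
open B15Prop1AtZSequenceRecord B15Prop1DatumSmall7AtZSequence B15Prop1Thm1GeneralFormAtZSequence B15Prop1Thm1GeneralFormShapes
open B15Prop1JointHolomorphyFromBackground B15Prop1OneSidedIneq17OfFun B15Prop1OneSidedIneq17Edition B15Prop1ValueOfAnyMinimiser
open B15Prop1JointHolomorphyFromMinimiserFamilyOneSided B15Prop1JointHolomorphyFromMinimiserFamily B15Prop1CoerciveOfFun
open B15Prop1ClosedGuardUniformRadius (plaqLeOn_of_plaqSmallOn forall_of_forall_isCompact_subset)
open B15Prop1AnalyticExtClause (cplxVec cplxSlice cplxSlice_apply norm_cplxSlice norm_cplxVec reSlice anExt anExt_antitone)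
open B15Prop1ChartCalculusSU2 (E3)
open T4CubeChartGnomonic (SU2)
open B15Prop1ChartSU2 (su2Chart)
open B15Prop1SliceCoordinates (GaugeSlice ιA freeBonds norm_ιA_apply_le)
open T4AxialGaugeSmallField (castSite boxPlaqs)
open T4AxialGaugeFixing (TreeOrder boxDepth)
open B7Prop1Explicit (e e_apply)
open B6BondElimination (unitVec)
open B6TreeGaugePoincare (curl)
open B16Eq18Proof (box mem_box)
open B15Extension193 (extend)
open B15ShellGauge193 (shellGauge)
open B5Bounds167Lattice (formDk ofRealCfg)
open B14DomainGeom (IsUnionOfCubes)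
open B15Eq112TorusCover (cover)
open B14.Eq213MaximalDomains (side)
open B14.Eq213DetSet B14.Eq216Concrete B15Sect1Instances B15Eq177GaugeInvariance B15Eq177ValueInvariance B15Eq177ValueInvarianceCoDiv B16Sect1Wilson
open B14.Eq22Determines (blockIter IsBlockUnion)
open Literature.MathematicalPhysics.QuantumFieldTheory.BalabanImbrieJaffe1984to88.BIJ85Eq453GaugeField
open B11Prop6Scheme (Prop4Hyp)
open T4Continuum
open Classical

/-! ## §1 The `Z`-sequence, guarded-[15]-letter, torus-class and value-matched endpoints with the (1.9) letter (twins of `B15Prop1OneSidedIneq17Edition` §3) -/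

section AtRecord

/-- **COERCIVE ((1.9)-letter) edition** (the `_oneSided` twin with `{γ₀} hγ₀ h17 hsm hγle` ↦ the (1.9) slice-Hessian coercivity letter `hcoer`). ★★★ **PROPOSITION 1 [IV] WITH ITS ANALYTIC-EXTENSION CLAUSE AT PRINT'S (1.74) OBJECT, WITH THE GRADIENT LETTER (L3) REPLACED BY THE NEAR-FIELD
VALUE LETTER (Vn)** — per instance the background `Node00.bgMSCoPOfRecord F 2 ν Kt (k i) (maxDomT ν.M₁ (Z i))` (NODE 00's constructor of record at
`Z`'s own maximal sequence, support `hull(Ω₁(Z))`; class invariance DISCHARGED by `gaugeAct_mem_regMSCoPOfRecord`); SUPERSEDES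
`B15Prop1GradientFromNearValueAtCoPRecord.…_atCoPRecord_ofNearValue` (p540333 §1; same letters, background of the RUN's class) for consumption.  WHAT A
CONSUMER SUPPLIES: (J1) `hGj`, (L2) `hcoer`, (Vn) `hVn : Σ_{p ∈ plaqsOf Ω₁(Z)} (1 − Re tr U_{k,Z}(ext V_k)(∂p)) ≤ cA·ε²` at `ε`-regular data —
print's (8) for `U_{k,Z}` ([IV] p. 193 ll. 17–20; at this background = [15] Thm 1 (8) for the admissible sequence `maxDomT ν.M₁ Z`, LOCATED-GENFORM of the
module docstring) via `B15Prop1GradientFromNearValueAtCoPRecord.nearValue_le_of_plaqSmallOn` — `hcJ' : 2cA·eR∕R + 4𝓐∕(R·eR) ≤ cJ`, the geometric letter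
`hfar` (`…AtCoPRecord.far_letter_of_box`), `0 < k i ≤ m + K`, structure, `hcl := Subsingleton.elim _ _`.
[cite: Balaban1989LargeFieldI, (1.74) p.192, Prop. 1 (1.77)–(1.78) p.194 (incl. the last clause), p.193; Balaban1988Convergent, p.255, (2.12)–(2.13) pp.256–257;
Balaban1985Variational, (2),(5),(6) p.278, Thm 1 (8) p.279, Prop. 9 p.309; Balaban1989LargeFieldII, (1.7)–(1.9) p.358, (1.11) p.358, (1.12)–(1.13) p.359] -/
theorem exists_domain_prop1Printed_lfVarOn_std_su2_box_intrinsic_analytic_atZSeqCoPRecord_ofNearValue_ofCoercive {F : T4Family}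
    (ν : Node00.Stage7Numerics) (Kt : ℕ) (hd3 : 3 ≤ (F.P Kt).d) (h0 : 0 < (F.P Kt).d) {ι : Type}
    [hdec : ∀ j, DecidableEq (PBond (F.P Kt) j)] (hcl : hdec = fun _ a b => Classical.propDecidable (a = b))
    (Z Λ : ι → Set (Site (F.P Kt) 0)) (k : ι → ℕ) (M : ι → ℝ) (hk0 : ∀ i, 0 < k i) (hk : ∀ i, k i ≤ (F.P Kt).m + (F.P Kt).K)
    (eR : ι → ℝ) (heR : ∀ i, 0 < eR i)
    (T : ∀ i, Finset (PBond (F.P Kt) (k i)))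
    (lo hi : ι → Fin (F.P Kt).d → ℤ) (n : ι → ℕ) (hn : ∀ i κ, hi i κ ≤ lo i κ + n i) (hN : ∀ i, n i + 2 < (F.P Kt).sitesPerDir (k i))
    (hbox : ∀ i, pts (k i) (Λ i) = (castSite '' Set.Icc (lo i) (hi i) : Set (Site (F.P Kt) (k i))))
    (hZ : ∀ i, (boxPlaqs (lo i - 1) (hi i + 1) : Set (Plaq (F.P Kt) (k i))) ⊆ plaqsInside (pts (k i) (Z i)))
    (hTG0 : ∀ i, T i = (box (fun κ => (hi i κ - lo i κ + 1).toNat) (lo i)).image fun x =>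
      (⟨castSite (x - unitVec ⟨0, h0⟩), ⟨0, h0⟩⟩ : PBond (F.P Kt) (k i)))
    (hN5 : ∀ i κ, ((hi i κ - lo i κ + 1).toNat : ℤ) + 5 < (F.P Kt).sitesPerDir (k i))
    (ext : ∀ i, GaugeField (F.P Kt) (k i) SU2 → GaugeField (F.P Kt) (k i) SU2)
    (hext : ∀ i Vk, ext i Vk = extend (pts (k i) (Λ i)) (shellGauge Vk (lo i) (hi i)) Vk)
    (hlohi : ∀ i, lo i ≤ hi i)
    {γ cJ bx : ℝ} (hγ : 0 < γ) (hcJ : 0 ≤ cJ) (hbx : 0 ≤ bx)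
    (hbxM : ∀ i, 12 * ((F.P Kt).d : ℝ) * ((n i : ℝ) + 2) ^ 2 ≤ bx * (M i) ^ 2)
    {R 𝓐 : ι → ℝ} (hM : ∀ i, 1 ≤ (M i)) (hR : ∀ i, 0 < R i) (h𝓐 : ∀ i, 0 ≤ 𝓐 i)
    -- (J1) the JOINT holomorphic extension of print's function in the datum perturbation and the field
    (hGj : ∀ i Vk, PlaqSmallOn (plaqsInside (pts (k i) (Z i ∩ (Λ i)ᶜ))) (eR i) Vk →
      ∃ 𝒢 : VecField (F.P Kt) (k i) (EuclideanSpace ℂ (Fin 3)) × VecField (F.P Kt) (k i) (EuclideanSpace ℂ (Fin 3)) → ℂ,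
        DifferentiableOn ℂ 𝒢 (ball 0 (R i)) ∧
        (∀ z ∈ ball (0 : VecField (F.P Kt) (k i) (EuclideanSpace ℂ (Fin 3)) × VecField (F.P Kt) (k i) (EuclideanSpace ℂ (Fin 3))) (R i), ‖𝒢 z‖ ≤ 𝓐 i) ∧
        ∀ p B' : VecField (F.P Kt) (k i) E3, ‖p‖ < R i → ‖B'‖ < R i →
          𝒢 (cplxVec p, cplxVec B') =
            ((fun177std (Node00.bgMSCoPOfRecord F 2 ν Kt (k i) (maxDomT ν.M₁ (Z i))) ν.M₁ (Z i) (k i)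
              (expMul su2Chart B' (ext i (expMul su2Chart p Vk))) : ℝ) : ℂ))
    -- (L2) = (1.9) p.358 AS THE LETTER: coercivity of the slice Hessian `D(∇ sliceFn)(0)` at `eR`-regular data (dag-n12-c's `hcoer`; replaces `{γ₀} h17 hsm hγle`)
    (hcoer : ∀ i Vk, PlaqSmallOn (plaqsInside (pts (k i) (Z i ∩ (Λ i)ᶜ))) (eR i) Vk → ∀ X : GaugeSlice (pts (k i) (Λ i)) (T i) E3,
      γ / (M i) ^ 5 * ‖X‖ ^ 2 ≤ ⟪X, (fderiv ℝ (rGrad (pts (k i) (Λ i)) (T i)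
              (sliceFn (pts (k i) (Λ i)) (T i)
                (fun177std (Node00.bgMSCoPOfRecord F 2 ν Kt (k i) (maxDomT ν.M₁ (Z i))) ν.M₁ (Z i) (k i)) (ext i Vk))) 0) X⟫)
    -- the geometric letter: the k-blocks over the bonds meeting `Λ^{(k)}` lie inside `Ω₁(Z)` (print: `Λ` deep inside `Z`)
    (hfar : ∀ i (b : PBond (F.P Kt) 0), b.src ∉ maxDomT ν.M₁ (Z i) 1 →
      (⟨blockIter (k i) b.src, b.dir⟩ : PBond (F.P Kt) (k i)) ∉ bondsOf (pts (k i) (Λ i)))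
    -- (Vn) the NEAR-FIELD part of (1.77) at the extended regular datum is small (replaces (L3))
    {cA : ℝ}
    (hVn : ∀ i ε Vk, 0 < ε → ε ≤ eR i → PlaqSmallOn (plaqsInside (pts (k i) (Z i ∩ (Λ i)ᶜ))) ε Vk →
      wilsonLoc ((plaqsOf (maxDomT ν.M₁ (Z i) 1)).indicator fun _ => (1 : ℝ))
        (bgKZstd (Node00.bgMSCoPOfRecord F 2 ν Kt (k i) (maxDomT ν.M₁ (Z i))) ν.M₁ (Z i) (k i) (ext i Vk)) ≤ cA * ε ^ 2)
    (hcJ' : ∀ i, 2 * cA * eR i / R i + 4 * 𝓐 i / (R i * eR i) ≤ cJ)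
    : ∃ a₁ : ι → ℝ, (∀ i, 0 < a₁ i) ∧
      B15.Prop1Printed (lfVarOn su2Chart fun i =>
        InstOn.std (Node00.bgMSCoPOfRecord F 2 ν Kt (k i) (maxDomT ν.M₁ (Z i))) ν.M₁ (Z i) (Λ i) (k i) (M i) (a₁ i)
          (anExt (pts (k i) (Λ i)) (T i)
            (fun177std (Node00.bgMSCoPOfRecord F 2 ν Kt (k i) (maxDomT ν.M₁ (Z i))) ν.M₁ (Z i) (k i)) (ext i)
            (min (1 / 2) (min (R i / 8) (γ / (M i) ^ 5 * (R i / 2) ^ 2 / (48 * (4 * 𝓐 i / R i + 1))))))) := by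
  subst hcl
  exact exists_domain_prop1Printed_lfVarOn_ofFun_intrinsic_analytic_ofCoercive hd3 h0 Z Λ k M
    (fun i => fun177std (Node00.bgMSCoPOfRecord F 2 ν Kt (k i) (maxDomT ν.M₁ (Z i))) ν.M₁ (Z i) (k i))
    (fun i u V => fun177std_bgOfRecord_gaugeAct (Node00.avOfRecord F 2 Kt)
      (gaugeAct_mem_regMSCoPOfRecord ν Kt (k i) (maxDomT ν.M₁ (Z i))) ν.M₁ (Z i) (hk i) u V)
    eR heR T lo hi n hn hN hbox hZ hTG0 hN5 ext hext hlohi hγ hcJ hbx hbxM hM hR h𝓐 hGj hcoer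
    (hJ_of_nearValue Z Λ k
      (fun i => fun177std (Node00.bgMSCoPOfRecord F 2 ν Kt (k i) (maxDomT ν.M₁ (Z i))) ν.M₁ (Z i) (k i))
      (fun i V => wilsonLoc ((plaqsOf (maxDomT ν.M₁ (Z i) 1)).indicator fun _ => (1 : ℝ))
        (bgKZstd (Node00.bgMSCoPOfRecord F 2 ν Kt (k i) (maxDomT ν.M₁ (Z i))) ν.M₁ (Z i) (k i) V))
      (fun _ _ => wilsonLoc_nonneg _ _ fun p => Set.indicator_nonneg (fun _ _ => zero_le_one) p) eR heR T ext hR hGj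
      (fun i Vk _ => fun177std_dichotomy (Node00.avOfRecord F 2 Kt)
        (Node00.regMSCoPOfRecord F 2 ν Kt (k i) (maxDomT ν.M₁ (Z i))) ν.M₁ (hk0 i) (hk i) (T i) (hfar i) (ext i Vk))
      hVn hcJ')

/-- **COERCIVE ((1.9)-letter) edition** (the `_oneSided` twin with `{γ₀} hγ₀ h17 hsm hγle` ↦ the (1.9) slice-Hessian coercivity letter `hcoer`). ★★★ **PROPOSITION 1 [IV] WITH ITS ANALYTIC-EXTENSION CLAUSE AT PRINT'S (1.74) OBJECT, THE [15] LETTER IN GUARDED CLOSED FORM** — g12's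
`…_atZSeqCoPRecord_ofThm1General` VERBATIM with `h15D` REPLACED by the guarded `h15G` (see `nearValue_letter_of_thm1Guarded`); every other binder unchanged.
WHAT A CONSUMER SUPPLIES per instance: (J1) `hGj`, (L2) `hcoer` (NODE 00's), `hfar`, (Gᵃ) `hZblk`, `0 < k i ≤ m + K`, structure, numerics
(`hcE`∕`heRa`∕`hB₃`∕`hcA`∕`ha₀`∕`hcJ'`), `hM2`, `hdiv`, `hcl := Subsingleton.elim _ _`; and ONCE per run: `h15G` (or, in NODE 00's house shape, `h15T`: `…_ofThm1TorusClass`).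
[cite: Balaban1989LargeFieldI, (1.74) p.192, Prop. 1 (1.77)–(1.78) p.194 (incl. the last clause), p.193, (1.79) p.195; Balaban1988Convergent, (2.1) p.254, p.255, (2.12)–(2.13)
pp.256–257, (2.16), (2.18) p.257; Balaban1985Variational, (1) p.277, (2),(5),(6),(7) p.278, Thm 1 (8) p.279, Prop. 9 p.309; Balaban1989LargeFieldII, (1.7)–(1.9) p.358, (1.11)
p.358, (1.12)–(1.13) p.359] -/
theorem exists_domain_prop1Printed_lfVarOn_std_su2_box_intrinsic_analytic_atZSeqCoPRecord_ofThm1Guarded_ofCoercive {F : T4Family}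
    (ν : Node00.Stage7Numerics) (Kt : ℕ) (hd3 : 3 ≤ (F.P Kt).d) (h0 : 0 < (F.P Kt).d) {ι : Type}
    [hdec : ∀ j, DecidableEq (PBond (F.P Kt) j)] (hcl : hdec = fun _ a b => Classical.propDecidable (a = b))
    (Z Λ : ι → Set (Site (F.P Kt) 0)) (k : ι → ℕ) (M : ι → ℝ) (hk0 : ∀ i, 0 < k i) (hk : ∀ i, k i ≤ (F.P Kt).m + (F.P Kt).K)
    (eR : ι → ℝ) (heR : ∀ i, 0 < eR i)
    (T : ∀ i, Finset (PBond (F.P Kt) (k i)))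
    (lo hi : ι → Fin (F.P Kt).d → ℤ) (n : ι → ℕ) (hn : ∀ i κ, hi i κ ≤ lo i κ + n i) (hN : ∀ i, n i + 2 < (F.P Kt).sitesPerDir (k i))
    (hbox : ∀ i, pts (k i) (Λ i) = (castSite '' Set.Icc (lo i) (hi i) : Set (Site (F.P Kt) (k i))))
    (hZ : ∀ i, (boxPlaqs (lo i - 1) (hi i + 1) : Set (Plaq (F.P Kt) (k i))) ⊆ plaqsInside (pts (k i) (Z i)))
    (hTG0 : ∀ i, T i = (box (fun κ => (hi i κ - lo i κ + 1).toNat) (lo i)).image fun x =>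
      (⟨castSite (x - unitVec ⟨0, h0⟩), ⟨0, h0⟩⟩ : PBond (F.P Kt) (k i)))
    (hN5 : ∀ i κ, ((hi i κ - lo i κ + 1).toNat : ℤ) + 5 < (F.P Kt).sitesPerDir (k i))
    (ext : ∀ i, GaugeField (F.P Kt) (k i) SU2 → GaugeField (F.P Kt) (k i) SU2)
    (hext : ∀ i Vk, ext i Vk = extend (pts (k i) (Λ i)) (shellGauge Vk (lo i) (hi i)) Vk)
    (hlohi : ∀ i, lo i ≤ hi i)
    {γ cJ bx : ℝ} (hγ : 0 < γ) (hcJ : 0 ≤ cJ) (hbx : 0 ≤ bx)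
    (hbxM : ∀ i, 12 * ((F.P Kt).d : ℝ) * ((n i : ℝ) + 2) ^ 2 ≤ bx * (M i) ^ 2)
    {R 𝓐 : ι → ℝ} (hM : ∀ i, 1 ≤ (M i)) (hR : ∀ i, 0 < R i) (h𝓐 : ∀ i, 0 ≤ 𝓐 i)
    -- (J1) the JOINT holomorphic extension of print's function in the datum perturbation and the field
    (hGj : ∀ i Vk, PlaqSmallOn (plaqsInside (pts (k i) (Z i ∩ (Λ i)ᶜ))) (eR i) Vk →
      ∃ 𝒢 : VecField (F.P Kt) (k i) (EuclideanSpace ℂ (Fin 3)) × VecField (F.P Kt) (k i) (EuclideanSpace ℂ (Fin 3)) → ℂ,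
        DifferentiableOn ℂ 𝒢 (ball 0 (R i)) ∧
        (∀ z ∈ ball (0 : VecField (F.P Kt) (k i) (EuclideanSpace ℂ (Fin 3)) × VecField (F.P Kt) (k i) (EuclideanSpace ℂ (Fin 3))) (R i), ‖𝒢 z‖ ≤ 𝓐 i) ∧
        ∀ p B' : VecField (F.P Kt) (k i) E3, ‖p‖ < R i → ‖B'‖ < R i →
          𝒢 (cplxVec p, cplxVec B') =
            ((fun177std (Node00.bgMSCoPOfRecord F 2 ν Kt (k i) (maxDomT ν.M₁ (Z i))) ν.M₁ (Z i) (k i)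
              (expMul su2Chart B' (ext i (expMul su2Chart p Vk))) : ℝ) : ℂ))
    -- (L2) = (1.9) p.358 AS THE LETTER: coercivity of the slice Hessian `D(∇ sliceFn)(0)` at `eR`-regular data (dag-n12-c's `hcoer`; replaces `{γ₀} h17 hsm hγle`)
    (hcoer : ∀ i Vk, PlaqSmallOn (plaqsInside (pts (k i) (Z i ∩ (Λ i)ᶜ))) (eR i) Vk → ∀ X : GaugeSlice (pts (k i) (Λ i)) (T i) E3,
      γ / (M i) ^ 5 * ‖X‖ ^ 2 ≤ ⟪X, (fderiv ℝ (rGrad (pts (k i) (Λ i)) (T i)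
              (sliceFn (pts (k i) (Λ i)) (T i)
                (fun177std (Node00.bgMSCoPOfRecord F 2 ν Kt (k i) (maxDomT ν.M₁ (Z i))) ν.M₁ (Z i) (k i)) (ext i Vk))) 0) X⟫)
    -- the geometric letter: the k-blocks over the bonds meeting `Λ^{(k)}` lie inside `Ω₁(Z)` (print: `Λ` deep inside `Z`)
    (hfar : ∀ i (b : PBond (F.P Kt) 0), b.src ∉ maxDomT ν.M₁ (Z i) 1 →
      (⟨blockIter (k i) b.src, b.dir⟩ : PBond (F.P Kt) (k i)) ∉ bondsOf (pts (k i) (Λ i)))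
    -- (Gᵃ) geometry of `Z`: a union of `k`-blocks (print's `Z` is a union of `M`-cubes of `T₁^{(k)}`; §4 derives it from the cube letter on the cover)
    (hZblk : ∀ i, IsBlockUnion (k i) (Z i))
    -- print's `M₁ ≥ 2` and the torus divisibility `L^{k}M₁ ∣ 2L^{m+K}` of the `LʲM₁`-cube partitions
    (hM2 : 2 ≤ ν.M₁) (hdiv : ∀ i, side (F.P Kt).L ν.M₁ (k i) ∣ (F.P Kt).sitesPerDir 0)
    -- bookkeeping constants
    {cE B₃ a₀ a₁' cA : ℝ} (hcE0 : 0 ≤ cE) (hcE : ∀ i, 12 * ((F.P Kt).d : ℝ) * ((n i : ℝ) + 2) ^ 2 ≤ cE) (hB₃ : 0 ≤ B₃)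
    (heRa : ∀ i, (cE + 1) * eR i ≤ a₁' ∧ B₃ * ((cE + 1) * eR i) ≤ ν.εreg) (ha₀ : ν.εreg ≤ a₀)
    (hcA : 1 / 2 * (B₃ * (cE + 1) * (F.P Kt).eta 1 ^ 2) ^ 2 * (Fintype.card (Plaq (F.P Kt) 0) : ℝ) ≤ cA)
    -- [15] THEOREM 1 (R), GUARDED CLOSED GENERAL-SEQUENCE FORM at `ν`, `Kt` (see `nearValue_letter_of_thm1Guarded`)
    (h15G : ∀ (k' : ℕ), k' ≤ (F.P Kt).m + (F.P Kt).K → side (F.P Kt).L ν.M₁ k' ∣ (F.P Kt).sitesPerDir 0 →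
      ∀ (D : ℕ → Set (Set (Site (F.P Kt) 0))) (s : B14.Eq218Concrete.Seq D k'),
      (∀ j, 1 ≤ j → j ≤ k' → IsUnionOfCubes (side (F.P Kt).L ν.M₁ j) (cover (F.P Kt) ⁻¹' s.Ω j)) →
      Node00.Sect2.SeqSeparated ν.M₁ s → 0 < ν.M₁ →
      ∀ (ε₀ : ℝ) (δ : ℕ → ℝ), (∀ j, j ≤ k' → 0 < δ j ∧ δ j ≤ a₁' ∧ B₃ * δ j ≤ ε₀) → (∀ j, j < k' → δ j ≤ 2 * δ (j + 1)) →
      (∀ j, j < k' → δ (j + 1) ≤ 2 * δ j) → ε₀ ≤ a₀ →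
      ∀ W : MSField (F.P Kt) SU2,
        Node00.Sect2.DataSmall7PTop (Node00.avOfRecord F 2 Kt) s.Ω (Node00.suppDomOfRecord F ν Kt s.Ω) k' δ W →
        ∀ U₀ : GaugeField (F.P Kt) 0 SU2, IsMinimizer (Node00.avOfRecord F 2 Kt)
            {U | (∀ j, j ≤ k' → PlaqSmallOn (Node00.Sect2.omegaPlaqsTop s.Ω (Node00.suppDomOfRecord F ν Kt s.Ω) j)
                (ε₀ * (F.P Kt).eta j ^ 2) U) ∧
              Node00.Sect2.CoDivClassOnTop s.Ω (Node00.suppDomOfRecord F ν Kt s.Ω) k' ε₀ U}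
            (genSet s.Ω k') W U₀ →
          (∀ j, j ≤ k' → PlaqSmallOn (Node00.Sect2.omegaPlaqsTop s.Ω (Node00.suppDomOfRecord F ν Kt s.Ω) j)
              (B₃ * δ j * (F.P Kt).eta j ^ 2) U₀) ∧
            ∀ j, j ≤ k' → Node00.Sect2.CoDivSmallOn (Node00.Sect2.omegaBondsTop s.Ω (Node00.suppDomOfRecord F ν Kt s.Ω) j)
              (B₃ * δ j * (F.P Kt).eta j ^ 3) U₀)
    (hcJ' : ∀ i, 2 * cA * eR i / R i + 4 * 𝓐 i / (R i * eR i) ≤ cJ)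
    : ∃ a₁ : ι → ℝ, (∀ i, 0 < a₁ i) ∧
      B15.Prop1Printed (lfVarOn su2Chart fun i =>
        InstOn.std (Node00.bgMSCoPOfRecord F 2 ν Kt (k i) (maxDomT ν.M₁ (Z i))) ν.M₁ (Z i) (Λ i) (k i) (M i) (a₁ i)
          (anExt (pts (k i) (Λ i)) (T i)
            (fun177std (Node00.bgMSCoPOfRecord F 2 ν Kt (k i) (maxDomT ν.M₁ (Z i))) ν.M₁ (Z i) (k i)) (ext i)
            (min (1 / 2) (min (R i / 8) (γ / (M i) ^ 5 * (R i / 2) ^ 2 / (48 * (4 * 𝓐 i / R i + 1))))))) :=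
  exists_domain_prop1Printed_lfVarOn_std_su2_box_intrinsic_analytic_atZSeqCoPRecord_ofNearValue_ofCoercive ν Kt hd3 h0 hcl Z Λ k M hk0 hk eR heR
    T lo hi n hn hN hbox hZ hTG0 hN5 ext hext hlohi hγ hcJ hbx hbxM hM hR h𝓐 hGj hcoer hfar
    (nearValue_letter_of_thm1Guarded ν Kt hd3 Z Λ k hk0 hk eR lo hi n hn hbox hZ hN5 ext hext hlohi hZblk hM2 hdiv hcE0 hcE hB₃
      heRa ha₀ hcA h15G) hcJ'

/-- **COERCIVE ((1.9)-letter) edition** (the `_oneSided` twin with `{γ₀} hγ₀ h17 hsm hγle` ↦ the (1.9) slice-Hessian coercivity letter `hcoer`). ★★★ **PROPOSITION 1 [IV] AT PRINT'S (1.74) OBJECT, THE [15] LETTER IN NODE 00's HOUSE SHAPE** — `…_ofThm1Guarded` with the guarded letter taken over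
NODE 00's torus-native class `fun j => Node00.unionsOfCubes P (LʲM₁)` (`h15T`, the shape of `Node00.DOfRecord`-indexed facts with `M·R_j` replaced by print's
[15] (1) cube size `M₁`); one line by `thm1Guarded_of_thm1TorusClass`.  Every other binder as in `…_ofThm1Guarded`.
[cite: Balaban1989LargeFieldI, (1.74) p.192, Prop. 1 (1.77)–(1.78) p.194 (incl. the last clause), p.193, (1.79) p.195; Balaban1988Convergent, (2.1) p.254, p.255, (2.12)–(2.13)
pp.256–257, (2.16)–(2.18) p.257; Balaban1985Variational, (1) p.277, (2),(5),(6),(7) p.278, Thm 1 (8) p.279, Prop. 9 p.309; Balaban1989LargeFieldII, (1.7)–(1.9) p.358, (1.11)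
p.358, (1.12)–(1.13) p.359] -/
theorem exists_domain_prop1Printed_lfVarOn_std_su2_box_intrinsic_analytic_atZSeqCoPRecord_ofThm1TorusClass_ofCoercive {F : T4Family}
    (ν : Node00.Stage7Numerics) (Kt : ℕ) (hd3 : 3 ≤ (F.P Kt).d) (h0 : 0 < (F.P Kt).d) {ι : Type}
    [hdec : ∀ j, DecidableEq (PBond (F.P Kt) j)] (hcl : hdec = fun _ a b => Classical.propDecidable (a = b))
    (Z Λ : ι → Set (Site (F.P Kt) 0)) (k : ι → ℕ) (M : ι → ℝ) (hk0 : ∀ i, 0 < k i) (hk : ∀ i, k i ≤ (F.P Kt).m + (F.P Kt).K)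
    (eR : ι → ℝ) (heR : ∀ i, 0 < eR i)
    (T : ∀ i, Finset (PBond (F.P Kt) (k i)))
    (lo hi : ι → Fin (F.P Kt).d → ℤ) (n : ι → ℕ) (hn : ∀ i κ, hi i κ ≤ lo i κ + n i) (hN : ∀ i, n i + 2 < (F.P Kt).sitesPerDir (k i))
    (hbox : ∀ i, pts (k i) (Λ i) = (castSite '' Set.Icc (lo i) (hi i) : Set (Site (F.P Kt) (k i))))
    (hZ : ∀ i, (boxPlaqs (lo i - 1) (hi i + 1) : Set (Plaq (F.P Kt) (k i))) ⊆ plaqsInside (pts (k i) (Z i)))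
    (hTG0 : ∀ i, T i = (box (fun κ => (hi i κ - lo i κ + 1).toNat) (lo i)).image fun x =>
      (⟨castSite (x - unitVec ⟨0, h0⟩), ⟨0, h0⟩⟩ : PBond (F.P Kt) (k i)))
    (hN5 : ∀ i κ, ((hi i κ - lo i κ + 1).toNat : ℤ) + 5 < (F.P Kt).sitesPerDir (k i))
    (ext : ∀ i, GaugeField (F.P Kt) (k i) SU2 → GaugeField (F.P Kt) (k i) SU2)
    (hext : ∀ i Vk, ext i Vk = extend (pts (k i) (Λ i)) (shellGauge Vk (lo i) (hi i)) Vk)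
    (hlohi : ∀ i, lo i ≤ hi i)
    {γ cJ bx : ℝ} (hγ : 0 < γ) (hcJ : 0 ≤ cJ) (hbx : 0 ≤ bx)
    (hbxM : ∀ i, 12 * ((F.P Kt).d : ℝ) * ((n i : ℝ) + 2) ^ 2 ≤ bx * (M i) ^ 2)
    {R 𝓐 : ι → ℝ} (hM : ∀ i, 1 ≤ (M i)) (hR : ∀ i, 0 < R i) (h𝓐 : ∀ i, 0 ≤ 𝓐 i)
    -- (J1) the JOINT holomorphic extension of print's function in the datum perturbation and the field
    (hGj : ∀ i Vk, PlaqSmallOn (plaqsInside (pts (k i) (Z i ∩ (Λ i)ᶜ))) (eR i) Vk →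
      ∃ 𝒢 : VecField (F.P Kt) (k i) (EuclideanSpace ℂ (Fin 3)) × VecField (F.P Kt) (k i) (EuclideanSpace ℂ (Fin 3)) → ℂ,
        DifferentiableOn ℂ 𝒢 (ball 0 (R i)) ∧
        (∀ z ∈ ball (0 : VecField (F.P Kt) (k i) (EuclideanSpace ℂ (Fin 3)) × VecField (F.P Kt) (k i) (EuclideanSpace ℂ (Fin 3))) (R i), ‖𝒢 z‖ ≤ 𝓐 i) ∧
        ∀ p B' : VecField (F.P Kt) (k i) E3, ‖p‖ < R i → ‖B'‖ < R i →
          𝒢 (cplxVec p, cplxVec B') =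
            ((fun177std (Node00.bgMSCoPOfRecord F 2 ν Kt (k i) (maxDomT ν.M₁ (Z i))) ν.M₁ (Z i) (k i)
              (expMul su2Chart B' (ext i (expMul su2Chart p Vk))) : ℝ) : ℂ))
    -- (L2) = (1.9) p.358 AS THE LETTER: coercivity of the slice Hessian `D(∇ sliceFn)(0)` at `eR`-regular data (dag-n12-c's `hcoer`; replaces `{γ₀} h17 hsm hγle`)
    (hcoer : ∀ i Vk, PlaqSmallOn (plaqsInside (pts (k i) (Z i ∩ (Λ i)ᶜ))) (eR i) Vk → ∀ X : GaugeSlice (pts (k i) (Λ i)) (T i) E3,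
      γ / (M i) ^ 5 * ‖X‖ ^ 2 ≤ ⟪X, (fderiv ℝ (rGrad (pts (k i) (Λ i)) (T i)
              (sliceFn (pts (k i) (Λ i)) (T i)
                (fun177std (Node00.bgMSCoPOfRecord F 2 ν Kt (k i) (maxDomT ν.M₁ (Z i))) ν.M₁ (Z i) (k i)) (ext i Vk))) 0) X⟫)
    -- the geometric letter: the k-blocks over the bonds meeting `Λ^{(k)}` lie inside `Ω₁(Z)` (print: `Λ` deep inside `Z`)
    (hfar : ∀ i (b : PBond (F.P Kt) 0), b.src ∉ maxDomT ν.M₁ (Z i) 1 →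
      (⟨blockIter (k i) b.src, b.dir⟩ : PBond (F.P Kt) (k i)) ∉ bondsOf (pts (k i) (Λ i)))
    -- (Gᵃ) geometry of `Z`: a union of `k`-blocks (print's `Z` is a union of `M`-cubes of `T₁^{(k)}`; §4 derives it from the cube letter on the cover)
    (hZblk : ∀ i, IsBlockUnion (k i) (Z i))
    -- print's `M₁ ≥ 2` and the torus divisibility `L^{k}M₁ ∣ 2L^{m+K}` of the `LʲM₁`-cube partitions
    (hM2 : 2 ≤ ν.M₁) (hdiv : ∀ i, side (F.P Kt).L ν.M₁ (k i) ∣ (F.P Kt).sitesPerDir 0)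
    -- bookkeeping constants
    {cE B₃ a₀ a₁' cA : ℝ} (hcE0 : 0 ≤ cE) (hcE : ∀ i, 12 * ((F.P Kt).d : ℝ) * ((n i : ℝ) + 2) ^ 2 ≤ cE) (hB₃ : 0 ≤ B₃)
    (heRa : ∀ i, (cE + 1) * eR i ≤ a₁' ∧ B₃ * ((cE + 1) * eR i) ≤ ν.εreg) (ha₀ : ν.εreg ≤ a₀)
    (hcA : 1 / 2 * (B₃ * (cE + 1) * (F.P Kt).eta 1 ^ 2) ^ 2 * (Fintype.card (Plaq (F.P Kt) 0) : ℝ) ≤ cA)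
    -- [15] THEOREM 1 (R), CLOSED GENERAL-SEQUENCE FORM, GUARDED, IN NODE 00's TORUS-NATIVE CLASS (shape (C)): indices over
    -- `fun j => Node00.unionsOfCubes P (LʲM₁)` (as `Node00.DOfRecord`), no separate cube letter
    (h15T : ∀ (k' : ℕ), k' ≤ (F.P Kt).m + (F.P Kt).K → side (F.P Kt).L ν.M₁ k' ∣ (F.P Kt).sitesPerDir 0 →
      ∀ (s : B14.Eq218Concrete.Seq (fun n : ℕ => Node00.unionsOfCubes (F.P Kt) (side (F.P Kt).L ν.M₁ n)) k'),
      Node00.Sect2.SeqSeparated ν.M₁ s → 0 < ν.M₁ →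
      ∀ (ε₀ : ℝ) (δ : ℕ → ℝ), (∀ j, j ≤ k' → 0 < δ j ∧ δ j ≤ a₁' ∧ B₃ * δ j ≤ ε₀) → (∀ j, j < k' → δ j ≤ 2 * δ (j + 1)) →
      (∀ j, j < k' → δ (j + 1) ≤ 2 * δ j) → ε₀ ≤ a₀ →
      ∀ W : MSField (F.P Kt) SU2,
        Node00.Sect2.DataSmall7PTop (Node00.avOfRecord F 2 Kt) s.Ω (Node00.suppDomOfRecord F ν Kt s.Ω) k' δ W →
        ∀ U₀ : GaugeField (F.P Kt) 0 SU2, IsMinimizer (Node00.avOfRecord F 2 Kt)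
            {U | (∀ j, j ≤ k' → PlaqSmallOn (Node00.Sect2.omegaPlaqsTop s.Ω (Node00.suppDomOfRecord F ν Kt s.Ω) j)
                (ε₀ * (F.P Kt).eta j ^ 2) U) ∧
              Node00.Sect2.CoDivClassOnTop s.Ω (Node00.suppDomOfRecord F ν Kt s.Ω) k' ε₀ U}
            (genSet s.Ω k') W U₀ →
          (∀ j, j ≤ k' → PlaqSmallOn (Node00.Sect2.omegaPlaqsTop s.Ω (Node00.suppDomOfRecord F ν Kt s.Ω) j)
              (B₃ * δ j * (F.P Kt).eta j ^ 2) U₀) ∧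
            ∀ j, j ≤ k' → Node00.Sect2.CoDivSmallOn (Node00.Sect2.omegaBondsTop s.Ω (Node00.suppDomOfRecord F ν Kt s.Ω) j)
              (B₃ * δ j * (F.P Kt).eta j ^ 3) U₀)
    (hcJ' : ∀ i, 2 * cA * eR i / R i + 4 * 𝓐 i / (R i * eR i) ≤ cJ)
    : ∃ a₁ : ι → ℝ, (∀ i, 0 < a₁ i) ∧
      B15.Prop1Printed (lfVarOn su2Chart fun i =>
        InstOn.std (Node00.bgMSCoPOfRecord F 2 ν Kt (k i) (maxDomT ν.M₁ (Z i))) ν.M₁ (Z i) (Λ i) (k i) (M i) (a₁ i)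
          (anExt (pts (k i) (Λ i)) (T i)
            (fun177std (Node00.bgMSCoPOfRecord F 2 ν Kt (k i) (maxDomT ν.M₁ (Z i))) ν.M₁ (Z i) (k i)) (ext i)
            (min (1 / 2) (min (R i / 8) (γ / (M i) ^ 5 * (R i / 2) ^ 2 / (48 * (4 * 𝓐 i / R i + 1))))))) :=
  exists_domain_prop1Printed_lfVarOn_std_su2_box_intrinsic_analytic_atZSeqCoPRecord_ofThm1Guarded_ofCoercive ν Kt hd3 h0 hcl Z Λ k M hk0 hk eR heR
    T lo hi n hn hN hbox hZ hTG0 hN5 ext hext hlohi hγ hcJ hbx hbxM hM hR h𝓐 hGj hcoer hfar hZblk hM2 hdiv hcE0 hcE hB₃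
    heRa ha₀ hcA (thm1Guarded_of_thm1TorusClass ν Kt (le_trans one_le_two hM2) h15T) hcJ'

/-- **COERCIVE ((1.9)-letter) edition** (the `_oneSided` twin with `{γ₀} hγ₀ h17 hsm hγle` ↦ the (1.9) slice-Hessian coercivity letter `hcoer`). ★★★ **PROPOSITION 1 [IV] AT PRINT'S (1.74) OBJECT, THE ANALYTIC INPUT IN PRINT'S (190) CURRENCY** —
`B15Prop1Thm1GeneralFormShapes.exists_domain_prop1Printed_lfVarOn_std_su2_box_intrinsic_analytic_atZSeqCoPRecord_ofThm1TorusClass` (p556967) VERBATIM but for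
the joint-holomorphy letter: (J1) `hGj` (ONE ℂ-differentiable bounded extension of the ACTION `(p, B′) ↦ A(U_{k,Z}(exp(iB′)·ext(exp(ip)V_k)))`) is REPLACED
by (J0ᵛ) `hBg` — ONE family of CONFIGURATIONS, bondwise in `M₂(ℂ)` with ℂ-differentiable entries bounded by `𝓐₀ i`, which at every real point of the ball IS
an `SU(2)` configuration carrying the value (1.77) ([Balaban1985Variational] Prop. 9 p. 309: «The minimal configuration U_k(V) … has an extension to an analytic
function of Gᶜ-valued small configurations V′» — any such family of (2.12) minimisers of the data inhabits (J0ᵛ), (1.77) being the value function; the letter is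
NOT pinned to the `Classical.choose` selector `UminOfRecord` of NODE 00's `bgMSCoPOfRecord`, n12-w1's LOCATED-SELECTOR) — and the action bound becomes the
explicit `𝓐 i := |Plaq (F.P Kt) 0| · (1 + 8(𝓐₀ i)⁴)` (§3) in `hcJ'` and in the clause's radius; `h𝓐` disappears.  Every other binder and the conclusion as in p556967.
[cite: Balaban1989LargeFieldI, (1.74) p.192, Prop. 1 (1.77)–(1.78) p.194 (incl. the last clause), p.193, (1.79) p.195; Balaban1989LargeFieldII, (1.7)–(1.9)
p.358, (1.12)–(1.13) p.359; Balaban1985Variational, (1) p.277, Thm 1 (8) p.279, Prop. 9 (190) p.309; Balaban1988Convergent, (2.12)–(2.14) pp.256–257,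
(2.16)–(2.18) p.257] -/
theorem exists_domain_prop1Printed_lfVarOn_std_su2_box_intrinsic_analytic_atZSeqCoPRecord_ofThm1TorusClass_ofValueMatched_ofCoercive {F : T4Family}
    (ν : Node00.Stage7Numerics) (Kt : ℕ) (hd3 : 3 ≤ (F.P Kt).d) (h0 : 0 < (F.P Kt).d) {ι : Type}
    [hdec : ∀ j, DecidableEq (PBond (F.P Kt) j)] (hcl : hdec = fun _ a b => Classical.propDecidable (a = b))
    (Z Λ : ι → Set (Site (F.P Kt) 0)) (k : ι → ℕ) (M : ι → ℝ) (hk0 : ∀ i, 0 < k i) (hk : ∀ i, k i ≤ (F.P Kt).m + (F.P Kt).K)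
    (eR : ι → ℝ) (heR : ∀ i, 0 < eR i)
    (T : ∀ i, Finset (PBond (F.P Kt) (k i)))
    (lo hi : ι → Fin (F.P Kt).d → ℤ) (n : ι → ℕ) (hn : ∀ i κ, hi i κ ≤ lo i κ + n i) (hN : ∀ i, n i + 2 < (F.P Kt).sitesPerDir (k i))
    (hbox : ∀ i, pts (k i) (Λ i) = (castSite '' Set.Icc (lo i) (hi i) : Set (Site (F.P Kt) (k i))))
    (hZ : ∀ i, (boxPlaqs (lo i - 1) (hi i + 1) : Set (Plaq (F.P Kt) (k i))) ⊆ plaqsInside (pts (k i) (Z i)))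
    (hTG0 : ∀ i, T i = (box (fun κ => (hi i κ - lo i κ + 1).toNat) (lo i)).image fun x =>
      (⟨castSite (x - unitVec ⟨0, h0⟩), ⟨0, h0⟩⟩ : PBond (F.P Kt) (k i)))
    (hN5 : ∀ i κ, ((hi i κ - lo i κ + 1).toNat : ℤ) + 5 < (F.P Kt).sitesPerDir (k i))
    (ext : ∀ i, GaugeField (F.P Kt) (k i) SU2 → GaugeField (F.P Kt) (k i) SU2)
    (hext : ∀ i Vk, ext i Vk = extend (pts (k i) (Λ i)) (shellGauge Vk (lo i) (hi i)) Vk)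
    (hlohi : ∀ i, lo i ≤ hi i)
    {γ cJ bx : ℝ} (hγ : 0 < γ) (hcJ : 0 ≤ cJ) (hbx : 0 ≤ bx)
    (hbxM : ∀ i, 12 * ((F.P Kt).d : ℝ) * ((n i : ℝ) + 2) ^ 2 ≤ bx * (M i) ^ 2)
    {R 𝓐₀ : ι → ℝ} (hM : ∀ i, 1 ≤ (M i)) (hR : ∀ i, 0 < R i)
    -- (J0ᵛ) ONE family along the chart family with ℂ-differentiable bounded matrix entries which at every real point IS an `SU(2)` configuration carrying
    -- the VALUE (1.77) — print's (190) currency (any holomorphic family of (2.12) minimisers inhabits it); not pinned to the selector `UminOfRecord`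
    (hBg : ∀ i Vk, PlaqSmallOn (plaqsInside (pts (k i) (Z i ∩ (Λ i)ᶜ))) (eR i) Vk →
      ∃ Ũ : VecField (F.P Kt) (k i) (EuclideanSpace ℂ (Fin 3)) × VecField (F.P Kt) (k i) (EuclideanSpace ℂ (Fin 3)) →
          PBond (F.P Kt) 0 → Matrix (Fin 2) (Fin 2) ℂ,
        (∀ b a c, DifferentiableOn ℂ (fun z => Ũ z b a c) (ball 0 (R i))) ∧
        (∀ z ∈ ball (0 : VecField (F.P Kt) (k i) (EuclideanSpace ℂ (Fin 3)) × VecField (F.P Kt) (k i) (EuclideanSpace ℂ (Fin 3))) (R i),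
          ∀ b a c, ‖Ũ z b a c‖ ≤ 𝓐₀ i) ∧
        ∀ p B' : VecField (F.P Kt) (k i) E3, ‖p‖ < R i → ‖B'‖ < R i → ∃ U' : GaugeField (F.P Kt) 0 SU2,
          (∀ b, Ũ (cplxVec p, cplxVec B') b = ((U' b : SU2) : Matrix (Fin 2) (Fin 2) ℂ)) ∧
            wilsonAction4 U' =
              fun177std (Node00.bgMSCoPOfRecord F 2 ν Kt (k i) (maxDomT ν.M₁ (Z i))) ν.M₁ (Z i) (k i)
                (expMul su2Chart B' (ext i (expMul su2Chart p Vk))))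
    -- (L2) = (1.9) p.358 AS THE LETTER: coercivity of the slice Hessian `D(∇ sliceFn)(0)` at `eR`-regular data (dag-n12-c's `hcoer`; replaces `{γ₀} h17 hsm hγle`)
    (hcoer : ∀ i Vk, PlaqSmallOn (plaqsInside (pts (k i) (Z i ∩ (Λ i)ᶜ))) (eR i) Vk → ∀ X : GaugeSlice (pts (k i) (Λ i)) (T i) E3,
      γ / (M i) ^ 5 * ‖X‖ ^ 2 ≤ ⟪X, (fderiv ℝ (rGrad (pts (k i) (Λ i)) (T i)
              (sliceFn (pts (k i) (Λ i)) (T i)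
                (fun177std (Node00.bgMSCoPOfRecord F 2 ν Kt (k i) (maxDomT ν.M₁ (Z i))) ν.M₁ (Z i) (k i)) (ext i Vk))) 0) X⟫)
    -- the geometric letter: the k-blocks over the bonds meeting `Λ^{(k)}` lie inside `Ω₁(Z)`
    (hfar : ∀ i (b : PBond (F.P Kt) 0), b.src ∉ maxDomT ν.M₁ (Z i) 1 →
      (⟨blockIter (k i) b.src, b.dir⟩ : PBond (F.P Kt) (k i)) ∉ bondsOf (pts (k i) (Λ i)))
    -- (Gᵃ) geometry of `Z`: a union of `k`-blocks
    (hZblk : ∀ i, IsBlockUnion (k i) (Z i))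
    -- print's `M₁ ≥ 2` and the torus divisibility `L^{k}M₁ ∣ 2L^{m+K}`
    (hM2 : 2 ≤ ν.M₁) (hdiv : ∀ i, side (F.P Kt).L ν.M₁ (k i) ∣ (F.P Kt).sitesPerDir 0)
    -- bookkeeping constants
    {cE B₃ a₀ a₁' cA : ℝ} (hcE0 : 0 ≤ cE) (hcE : ∀ i, 12 * ((F.P Kt).d : ℝ) * ((n i : ℝ) + 2) ^ 2 ≤ cE) (hB₃ : 0 ≤ B₃)
    (heRa : ∀ i, (cE + 1) * eR i ≤ a₁' ∧ B₃ * ((cE + 1) * eR i) ≤ ν.εreg) (ha₀ : ν.εreg ≤ a₀)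
    (hcA : 1 / 2 * (B₃ * (cE + 1) * (F.P Kt).eta 1 ^ 2) ^ 2 * (Fintype.card (Plaq (F.P Kt) 0) : ℝ) ≤ cA)
    -- [15] THEOREM 1 (R), CLOSED GENERAL-SEQUENCE FORM, GUARDED, IN NODE 00's TORUS-NATIVE CLASS (shape (C)) — served by K0⁷'s def (n12-d 12Q⁵)
    (h15T : ∀ (k' : ℕ), k' ≤ (F.P Kt).m + (F.P Kt).K → side (F.P Kt).L ν.M₁ k' ∣ (F.P Kt).sitesPerDir 0 →
      ∀ (s : B14.Eq218Concrete.Seq (fun n : ℕ => Node00.unionsOfCubes (F.P Kt) (side (F.P Kt).L ν.M₁ n)) k'),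
      Node00.Sect2.SeqSeparated ν.M₁ s → 0 < ν.M₁ →
      ∀ (ε₀ : ℝ) (δ : ℕ → ℝ), (∀ j, j ≤ k' → 0 < δ j ∧ δ j ≤ a₁' ∧ B₃ * δ j ≤ ε₀) → (∀ j, j < k' → δ j ≤ 2 * δ (j + 1)) →
      (∀ j, j < k' → δ (j + 1) ≤ 2 * δ j) → ε₀ ≤ a₀ →
      ∀ W : MSField (F.P Kt) SU2,
        Node00.Sect2.DataSmall7PTop (Node00.avOfRecord F 2 Kt) s.Ω (Node00.suppDomOfRecord F ν Kt s.Ω) k' δ W →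
        ∀ U₀ : GaugeField (F.P Kt) 0 SU2, IsMinimizer (Node00.avOfRecord F 2 Kt)
            {U | (∀ j, j ≤ k' → PlaqSmallOn (Node00.Sect2.omegaPlaqsTop s.Ω (Node00.suppDomOfRecord F ν Kt s.Ω) j)
                (ε₀ * (F.P Kt).eta j ^ 2) U) ∧
              Node00.Sect2.CoDivClassOnTop s.Ω (Node00.suppDomOfRecord F ν Kt s.Ω) k' ε₀ U}
            (genSet s.Ω k') W U₀ →
          (∀ j, j ≤ k' → PlaqSmallOn (Node00.Sect2.omegaPlaqsTop s.Ω (Node00.suppDomOfRecord F ν Kt s.Ω) j)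
              (B₃ * δ j * (F.P Kt).eta j ^ 2) U₀) ∧
            ∀ j, j ≤ k' → Node00.Sect2.CoDivSmallOn (Node00.Sect2.omegaBondsTop s.Ω (Node00.suppDomOfRecord F ν Kt s.Ω) j)
              (B₃ * δ j * (F.P Kt).eta j ^ 3) U₀)
    (hcJ' : ∀ i, 2 * cA * eR i / R i + 4 * ((Fintype.card (Plaq (F.P Kt) 0) : ℝ) * (1 + 8 * 𝓐₀ i ^ 4)) / (R i * eR i) ≤ cJ)
    : ∃ a₁ : ι → ℝ, (∀ i, 0 < a₁ i) ∧
      B15.Prop1Printed (lfVarOn su2Chart fun i =>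
        InstOn.std (Node00.bgMSCoPOfRecord F 2 ν Kt (k i) (maxDomT ν.M₁ (Z i))) ν.M₁ (Z i) (Λ i) (k i) (M i) (a₁ i)
          (anExt (pts (k i) (Λ i)) (T i)
            (fun177std (Node00.bgMSCoPOfRecord F 2 ν Kt (k i) (maxDomT ν.M₁ (Z i))) ν.M₁ (Z i) (k i)) (ext i)
            (min (1 / 2) (min (R i / 8) (γ / (M i) ^ 5 * (R i / 2) ^ 2 /
              (48 * (4 * ((Fintype.card (Plaq (F.P Kt) 0) : ℝ) * (1 + 8 * 𝓐₀ i ^ 4)) / R i + 1))))))) :=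
  exists_domain_prop1Printed_lfVarOn_std_su2_box_intrinsic_analytic_atZSeqCoPRecord_ofThm1TorusClass_ofCoercive ν Kt hd3 h0 hcl Z Λ k M hk0 hk eR heR
    T lo hi n hn hN hbox hZ hTG0 hN5 ext hext hlohi hγ hcJ hbx hbxM (𝓐 := fun i => (Fintype.card (Plaq (F.P Kt) 0) : ℝ) * (1 + 8 * 𝓐₀ i ^ 4))
    hM hR (fun i => by positivity)
    (fun i Vk hV => jointHolomorphic_fun177std_of_valueMatched _ _ _ _ _ _ (hBg i Vk hV)) hcoer hfar hZblk hM2 hdiv hcE0 hcE hB₃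
    heRa ha₀ hcA h15T hcJ'

/-! ## §2 The endpoint with the letter (J0′) — a holomorphic family of (2.12) minimisers (twin of `B15Prop1JointHolomorphyFromMinimiserFamilyOneSided`) -/

/-- ★★★ **PROPOSITION 1 [IV] AT PRINT'S (1.74) OBJECT — COERCIVE ((1.9)-LETTER) EDITION (the `_oneSided` twin with `{γ₀} hγ₀ h17 hsm hγle` ↦ `hcoer`) — WITH THE ANALYTIC INPUT AS A HOLOMORPHIC FAMILY OF (2.12) MINIMISERS**: dag-n12-c's
`B15Prop1OneSidedIneq17Edition.exists_domain_prop1Printed_lfVarOn_std_su2_box_intrinsic_analytic_atZSeqCoPRecord_ofThm1TorusClass_ofValueMatched_oneSided` VERBATIM but for the configuration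
letter: (J0ᵛ) `hBg` is REPLACED by the INTRINSIC (J0′) `hMin` (SOME minimal configuration of the (2.12) problem of each real point's datum in NODE 00's class of record; print's
`U_k(V′)`, [Balaban1985Variational] Prop. 9 p. 309).  One application after the value junction ((1.77) is the value function).
[cite: Balaban1989LargeFieldI, (1.74) p.192, Prop. 1 (1.77)–(1.78) p.194 (incl. the last clause), (1.79) p.195; Balaban1989LargeFieldII, (1.7)–(1.9) p.358, (1.12)–(1.13) p.359;
Balaban1985Variational, Thm 1 (8) p.279, Prop. 9 (190) p.309; Balaban1988Convergent, (2.12)–(2.14) pp.256–257] -/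
theorem exists_domain_prop1Printed_lfVarOn_std_su2_box_intrinsic_analytic_atZSeqCoPRecord_ofThm1TorusClass_ofMinimiserFamily_ofCoercive {F : T4Family}
    (ν : Node00.Stage7Numerics) (Kt : ℕ) (hd3 : 3 ≤ (F.P Kt).d) (h0 : 0 < (F.P Kt).d) {ι : Type}
    [hdec : ∀ j, DecidableEq (PBond (F.P Kt) j)] (hcl : hdec = fun _ a b => Classical.propDecidable (a = b))
    (Z Λ : ι → Set (Site (F.P Kt) 0)) (k : ι → ℕ) (M : ι → ℝ) (hk0 : ∀ i, 0 < k i) (hk : ∀ i, k i ≤ (F.P Kt).m + (F.P Kt).K)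
    (eR : ι → ℝ) (heR : ∀ i, 0 < eR i)
    (T : ∀ i, Finset (PBond (F.P Kt) (k i)))
    (lo hi : ι → Fin (F.P Kt).d → ℤ) (n : ι → ℕ) (hn : ∀ i κ, hi i κ ≤ lo i κ + n i) (hN : ∀ i, n i + 2 < (F.P Kt).sitesPerDir (k i))
    (hbox : ∀ i, pts (k i) (Λ i) = (castSite '' Set.Icc (lo i) (hi i) : Set (Site (F.P Kt) (k i))))
    (hZ : ∀ i, (boxPlaqs (lo i - 1) (hi i + 1) : Set (Plaq (F.P Kt) (k i))) ⊆ plaqsInside (pts (k i) (Z i)))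
    (hTG0 : ∀ i, T i = (box (fun κ => (hi i κ - lo i κ + 1).toNat) (lo i)).image fun x =>
      (⟨castSite (x - unitVec ⟨0, h0⟩), ⟨0, h0⟩⟩ : PBond (F.P Kt) (k i)))
    (hN5 : ∀ i κ, ((hi i κ - lo i κ + 1).toNat : ℤ) + 5 < (F.P Kt).sitesPerDir (k i))
    (ext : ∀ i, GaugeField (F.P Kt) (k i) SU2 → GaugeField (F.P Kt) (k i) SU2)
    (hext : ∀ i Vk, ext i Vk = extend (pts (k i) (Λ i)) (shellGauge Vk (lo i) (hi i)) Vk)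
    (hlohi : ∀ i, lo i ≤ hi i)
    {γ cJ bx : ℝ} (hγ : 0 < γ) (hcJ : 0 ≤ cJ) (hbx : 0 ≤ bx)
    (hbxM : ∀ i, 12 * ((F.P Kt).d : ℝ) * ((n i : ℝ) + 2) ^ 2 ≤ bx * (M i) ^ 2)
    {R 𝓐₀ : ι → ℝ} (hM : ∀ i, 1 ≤ (M i)) (hR : ∀ i, 0 < R i)
    -- (J0′) ONE family along the chart family with ℂ-differentiable bounded matrix entries which at every real point IS SOME (2.12) MINIMISER of that
    -- point's datum in the class of record — print's object `U_k(V′)` of [15] Prop. 9 (190); intrinsic (not pinned to the selector `UminOfRecord`)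
    (hMin : ∀ i Vk, PlaqSmallOn (plaqsInside (pts (k i) (Z i ∩ (Λ i)ᶜ))) (eR i) Vk →
      ∃ Ũ : VecField (F.P Kt) (k i) (EuclideanSpace ℂ (Fin 3)) × VecField (F.P Kt) (k i) (EuclideanSpace ℂ (Fin 3)) →
          PBond (F.P Kt) 0 → Matrix (Fin 2) (Fin 2) ℂ,
        (∀ b a c, DifferentiableOn ℂ (fun z => Ũ z b a c) (ball 0 (R i))) ∧
        (∀ z ∈ ball (0 : VecField (F.P Kt) (k i) (EuclideanSpace ℂ (Fin 3)) × VecField (F.P Kt) (k i) (EuclideanSpace ℂ (Fin 3))) (R i),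
          ∀ b a c, ‖Ũ z b a c‖ ≤ 𝓐₀ i) ∧
        ∀ p B' : VecField (F.P Kt) (k i) E3, ‖p‖ < R i → ‖B'‖ < R i → ∃ U' : GaugeField (F.P Kt) 0 SU2,
          (∀ b, Ũ (cplxVec p, cplxVec B') b = ((U' b : SU2) : Matrix (Fin 2) (Fin 2) ℂ)) ∧
            IsMinimizer (Node00.avOfRecord F 2 Kt) (Node00.regMSCoPOfRecord F 2 ν Kt (k i) (maxDomT ν.M₁ (Z i))) (Bj ν.M₁ (Z i) (k i))
              (avgFamily (Node00.avOfRecord F 2 Kt) (qsstarGIter0 (k i) (expMul su2Chart B' (ext i (expMul su2Chart p Vk))))) U')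
    -- (L2) = (1.9) p.358 AS THE LETTER: coercivity of the slice Hessian `D(∇ sliceFn)(0)` at `eR`-regular data (dag-n12-c's `hcoer`; replaces `{γ₀} h17 hsm hγle`)
    (hcoer : ∀ i Vk, PlaqSmallOn (plaqsInside (pts (k i) (Z i ∩ (Λ i)ᶜ))) (eR i) Vk → ∀ X : GaugeSlice (pts (k i) (Λ i)) (T i) E3,
      γ / (M i) ^ 5 * ‖X‖ ^ 2 ≤ ⟪X, (fderiv ℝ (rGrad (pts (k i) (Λ i)) (T i)
              (sliceFn (pts (k i) (Λ i)) (T i)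
                (fun177std (Node00.bgMSCoPOfRecord F 2 ν Kt (k i) (maxDomT ν.M₁ (Z i))) ν.M₁ (Z i) (k i)) (ext i Vk))) 0) X⟫)
    -- the geometric letter: the k-blocks over the bonds meeting `Λ^{(k)}` lie inside `Ω₁(Z)`
    (hfar : ∀ i (b : PBond (F.P Kt) 0), b.src ∉ maxDomT ν.M₁ (Z i) 1 →
      (⟨blockIter (k i) b.src, b.dir⟩ : PBond (F.P Kt) (k i)) ∉ bondsOf (pts (k i) (Λ i)))
    -- (Gᵃ) geometry of `Z`: a union of `k`-blocks
    (hZblk : ∀ i, IsBlockUnion (k i) (Z i))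
    -- print's `M₁ ≥ 2` and the torus divisibility `L^{k}M₁ ∣ 2L^{m+K}`
    (hM2 : 2 ≤ ν.M₁) (hdiv : ∀ i, side (F.P Kt).L ν.M₁ (k i) ∣ (F.P Kt).sitesPerDir 0)
    -- bookkeeping constants
    {cE B₃ a₀ a₁' cA : ℝ} (hcE0 : 0 ≤ cE) (hcE : ∀ i, 12 * ((F.P Kt).d : ℝ) * ((n i : ℝ) + 2) ^ 2 ≤ cE) (hB₃ : 0 ≤ B₃)
    (heRa : ∀ i, (cE + 1) * eR i ≤ a₁' ∧ B₃ * ((cE + 1) * eR i) ≤ ν.εreg) (ha₀ : ν.εreg ≤ a₀)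
    (hcA : 1 / 2 * (B₃ * (cE + 1) * (F.P Kt).eta 1 ^ 2) ^ 2 * (Fintype.card (Plaq (F.P Kt) 0) : ℝ) ≤ cA)
    -- [15] THEOREM 1 (R), CLOSED GENERAL-SEQUENCE FORM, GUARDED, IN NODE 00's TORUS-NATIVE CLASS (shape (C)) — served by K0⁷'s def (n12-d 12Q⁵)
    (h15T : ∀ (k' : ℕ), k' ≤ (F.P Kt).m + (F.P Kt).K → side (F.P Kt).L ν.M₁ k' ∣ (F.P Kt).sitesPerDir 0 →
      ∀ (s : B14.Eq218Concrete.Seq (fun n : ℕ => Node00.unionsOfCubes (F.P Kt) (side (F.P Kt).L ν.M₁ n)) k'),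
      Node00.Sect2.SeqSeparated ν.M₁ s → 0 < ν.M₁ →
      ∀ (ε₀ : ℝ) (δ : ℕ → ℝ), (∀ j, j ≤ k' → 0 < δ j ∧ δ j ≤ a₁' ∧ B₃ * δ j ≤ ε₀) → (∀ j, j < k' → δ j ≤ 2 * δ (j + 1)) →
      (∀ j, j < k' → δ (j + 1) ≤ 2 * δ j) → ε₀ ≤ a₀ →
      ∀ W : MSField (F.P Kt) SU2,
        Node00.Sect2.DataSmall7PTop (Node00.avOfRecord F 2 Kt) s.Ω (Node00.suppDomOfRecord F ν Kt s.Ω) k' δ W →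
        ∀ U₀ : GaugeField (F.P Kt) 0 SU2, IsMinimizer (Node00.avOfRecord F 2 Kt)
            {U | (∀ j, j ≤ k' → PlaqSmallOn (Node00.Sect2.omegaPlaqsTop s.Ω (Node00.suppDomOfRecord F ν Kt s.Ω) j)
                (ε₀ * (F.P Kt).eta j ^ 2) U) ∧
              Node00.Sect2.CoDivClassOnTop s.Ω (Node00.suppDomOfRecord F ν Kt s.Ω) k' ε₀ U}
            (genSet s.Ω k') W U₀ →
          (∀ j, j ≤ k' → PlaqSmallOn (Node00.Sect2.omegaPlaqsTop s.Ω (Node00.suppDomOfRecord F ν Kt s.Ω) j)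
              (B₃ * δ j * (F.P Kt).eta j ^ 2) U₀) ∧
            ∀ j, j ≤ k' → Node00.Sect2.CoDivSmallOn (Node00.Sect2.omegaBondsTop s.Ω (Node00.suppDomOfRecord F ν Kt s.Ω) j)
              (B₃ * δ j * (F.P Kt).eta j ^ 3) U₀)
    (hcJ' : ∀ i, 2 * cA * eR i / R i + 4 * ((Fintype.card (Plaq (F.P Kt) 0) : ℝ) * (1 + 8 * 𝓐₀ i ^ 4)) / (R i * eR i) ≤ cJ)
    : ∃ a₁ : ι → ℝ, (∀ i, 0 < a₁ i) ∧
      B15.Prop1Printed (lfVarOn su2Chart fun i =>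
        InstOn.std (Node00.bgMSCoPOfRecord F 2 ν Kt (k i) (maxDomT ν.M₁ (Z i))) ν.M₁ (Z i) (Λ i) (k i) (M i) (a₁ i)
          (anExt (pts (k i) (Λ i)) (T i)
            (fun177std (Node00.bgMSCoPOfRecord F 2 ν Kt (k i) (maxDomT ν.M₁ (Z i))) ν.M₁ (Z i) (k i)) (ext i)
            (min (1 / 2) (min (R i / 8) (γ / (M i) ^ 5 * (R i / 2) ^ 2 /
              (48 * (4 * ((Fintype.card (Plaq (F.P Kt) 0) : ℝ) * (1 + 8 * 𝓐₀ i ^ 4)) / R i + 1))))))) :=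
  exists_domain_prop1Printed_lfVarOn_std_su2_box_intrinsic_analytic_atZSeqCoPRecord_ofThm1TorusClass_ofValueMatched_ofCoercive ν Kt hd3 h0 hcl Z Λ k M hk0 hk
    eR heR T lo hi n hn hN hbox hZ hTG0 hN5 ext hext hlohi hγ hcJ hbx hbxM hM hR
    (fun i Vk hV => by
      obtain ⟨Ũ, hdiff, hbd, hreal⟩ := hMin i Vk hV
      refine ⟨Ũ, hdiff, hbd, fun p B' hp hB' => ?_⟩
      obtain ⟨U', hU', hmin⟩ := hreal p B' hp hB'
      exact ⟨U', hU', (fun177std_bgMSCoPOfRecord_eq_wilsonAction4_of_isMinimizer (N := 2) ν Kt (k i) (maxDomT ν.M₁ (Z i)) ν.M₁ (Z i) (k i) hmin).symm⟩)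
    hcoer hfar hZblk hM2 hdiv hcE0 hcE hB₃ heRa ha₀ hcA h15T hcJ'


end AtRecord

/-! ## §3 The compact-uniform letter (J0′) on the closed guard, `R` produced, `cJ` absorbed (twins of `B15Prop1ClosedGuardUniformRadius` §3 ∕ §4, one-sided) -/

section Compact

/-- A real-valued family over a finite index has a nonnegative upper bound (private copy of `B15Prop1ClosedGuardUniformRadius`'s bookkeeping lemma).
[cite: Balaban1989LargeFieldI, Prop. 1 p.194] -/
private theorem exists_forall_le_of_finite {ι : Type*} [Finite ι] (t : ι → ℝ) : ∃ c : ℝ, 0 ≤ c ∧ ∀ i, t i ≤ c := by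
  rcases isEmpty_or_nonempty ι with h | h
  · exact ⟨0, le_rfl, fun i => (IsEmpty.false i).elim⟩
  · obtain ⟨i₀, hi₀⟩ := Finite.exists_max t
    exact ⟨max 0 (t i₀), le_max_left _ _, fun i => (hi₀ i).trans (le_max_right _ _)⟩

/-- ★★★ **PROPOSITION 1 [IV] AT PRINT'S (1.74) OBJECT — COERCIVE ((1.9)-LETTER) EDITION (the `_oneSided` twin with `{γ₀} hγ₀ h17 hsm hγle` ↦ `hcoer`) — WITH THE CONFIGURATION LETTER (J0′) IN COMPACT-UNIFORM FORM.**  dag-n12-w1's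
`B15Prop1JointHolomorphyFromMinimiserFamilyOneSided.…_ofMinimiserFamily_oneSided` (p589595) VERBATIM but: (a) the letter `hMin` is replaced by `hMinK` — per instance `i`,
SOME radius `R > 0` such that for EVERY base field `V_k` of the CLOSED guard `|V_k(∂p) − 1| ≤ eR i` (`p` a plaquette in `Z ∖ Λ` up to scale `k`) one family of bond
matrices on the sup-ball `ball 0 R`, entrywise ℂ-differentiable, bounded by `𝓐₀ i`, equal at every real `(p, B′)` to SOME (2.12) minimiser of that point's datum in the class of
record (print's `U_k(V′)`, [15] Prop. 9 (190); «analytic function of B′ … e.g. |B′| < ε», [IV] p. 194) — the shape the compactness route delivers (§4); (b) the radius `R` is no longer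
a binder but PRODUCED (`∃ R` in the conclusion, inside the analyticity radius of the carrier `InstOn.std` exactly as before); (c) the bookkeeping letter `hcJ'` and the constant
`cJ` are REMOVED — with `[Finite ι]` (one finite lattice carries finitely many Prop-1 instances) `cJ := max_i (2cA·eR i∕R i + 4|Plaq|(1+8(𝓐₀ i)⁴)∕(R i·eR i))` is chosen
inside.  Every other binder ((L2) `hcoer`, `hfar`, (Gᵃ) `hZblk`, `hM2`∕`hdiv`, constants, [15] Thm 1 `h15T`) VERBATIM.
[cite: Balaban1989LargeFieldI, (1.74) p.192, Prop. 1 (1.77)–(1.78) p.194 (incl. the last clause), (1.79) p.195; Balaban1989LargeFieldII, (1.7)–(1.9) p.358, (1.12)–(1.13) p.359;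
Balaban1985Variational, (7) p.278, Thm 1 (8) p.279, Prop. 9 (190) p.309; Balaban1988Convergent, (2.12)–(2.14) pp.256–257] -/
theorem exists_domain_prop1Printed_lfVarOn_std_su2_box_intrinsic_analytic_atZSeqCoPRecord_ofThm1TorusClass_ofMinimiserFamilyUniform_ofCoercive {F : T4Family}
    (ν : Node00.Stage7Numerics) (Kt : ℕ) (hd3 : 3 ≤ (F.P Kt).d) (h0 : 0 < (F.P Kt).d) {ι : Type} [Finite ι]
    [hdec : ∀ j, DecidableEq (PBond (F.P Kt) j)] (hcl : hdec = fun _ a b => Classical.propDecidable (a = b))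
    (Z Λ : ι → Set (Site (F.P Kt) 0)) (k : ι → ℕ) (M : ι → ℝ) (hk0 : ∀ i, 0 < k i) (hk : ∀ i, k i ≤ (F.P Kt).m + (F.P Kt).K)
    (eR : ι → ℝ) (heR : ∀ i, 0 < eR i)
    (T : ∀ i, Finset (PBond (F.P Kt) (k i)))
    (lo hi : ι → Fin (F.P Kt).d → ℤ) (n : ι → ℕ) (hn : ∀ i κ, hi i κ ≤ lo i κ + n i) (hN : ∀ i, n i + 2 < (F.P Kt).sitesPerDir (k i))
    (hbox : ∀ i, pts (k i) (Λ i) = (castSite '' Set.Icc (lo i) (hi i) : Set (Site (F.P Kt) (k i))))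
    (hZ : ∀ i, (boxPlaqs (lo i - 1) (hi i + 1) : Set (Plaq (F.P Kt) (k i))) ⊆ plaqsInside (pts (k i) (Z i)))
    (hTG0 : ∀ i, T i = (box (fun κ => (hi i κ - lo i κ + 1).toNat) (lo i)).image fun x =>
      (⟨castSite (x - unitVec ⟨0, h0⟩), ⟨0, h0⟩⟩ : PBond (F.P Kt) (k i)))
    (hN5 : ∀ i κ, ((hi i κ - lo i κ + 1).toNat : ℤ) + 5 < (F.P Kt).sitesPerDir (k i))
    (ext : ∀ i, GaugeField (F.P Kt) (k i) SU2 → GaugeField (F.P Kt) (k i) SU2)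
    (hext : ∀ i Vk, ext i Vk = extend (pts (k i) (Λ i)) (shellGauge Vk (lo i) (hi i)) Vk)
    (hlohi : ∀ i, lo i ≤ hi i)
    {γ bx : ℝ} (hγ : 0 < γ) (hbx : 0 ≤ bx)
    (hbxM : ∀ i, 12 * ((F.P Kt).d : ℝ) * ((n i : ℝ) + 2) ^ 2 ≤ bx * (M i) ^ 2)
    {𝓐₀ : ι → ℝ} (hM : ∀ i, 1 ≤ (M i))
    -- (J0′) COMPACT-UNIFORM FORM ON THE CLOSED GUARD: per instance SOME radius `R > 0` serving every `V_k` with `|V_k(∂p) − 1| ≤ eR i` on `Z ∖ Λ` up to scale `k`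
    (hMinK : ∀ i, ∃ R : ℝ, 0 < R ∧ ∀ Vk : GaugeField (F.P Kt) (k i) SU2,
      (∀ p ∈ plaqsInside (pts (k i) (Z i ∩ (Λ i)ᶜ)), dist1 (GaugeField.plaqHol Vk p) ≤ eR i) →
      ∃ Ũ : VecField (F.P Kt) (k i) (EuclideanSpace ℂ (Fin 3)) × VecField (F.P Kt) (k i) (EuclideanSpace ℂ (Fin 3)) →
          PBond (F.P Kt) 0 → Matrix (Fin 2) (Fin 2) ℂ,
        (∀ b a c, DifferentiableOn ℂ (fun z => Ũ z b a c) (ball 0 R)) ∧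
        (∀ z ∈ ball (0 : VecField (F.P Kt) (k i) (EuclideanSpace ℂ (Fin 3)) × VecField (F.P Kt) (k i) (EuclideanSpace ℂ (Fin 3))) R,
          ∀ b a c, ‖Ũ z b a c‖ ≤ 𝓐₀ i) ∧
        ∀ p B' : VecField (F.P Kt) (k i) E3, ‖p‖ < R → ‖B'‖ < R → ∃ U' : GaugeField (F.P Kt) 0 SU2,
          (∀ b, Ũ (cplxVec p, cplxVec B') b = ((U' b : SU2) : Matrix (Fin 2) (Fin 2) ℂ)) ∧
            IsMinimizer (Node00.avOfRecord F 2 Kt) (Node00.regMSCoPOfRecord F 2 ν Kt (k i) (maxDomT ν.M₁ (Z i))) (Bj ν.M₁ (Z i) (k i))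
              (avgFamily (Node00.avOfRecord F 2 Kt) (qsstarGIter0 (k i) (expMul su2Chart B' (ext i (expMul su2Chart p Vk))))) U')
    -- (L2) = (1.9) p.358 AS THE LETTER: coercivity of the slice Hessian `D(∇ sliceFn)(0)` at `eR`-regular data (dag-n12-c's `hcoer`; replaces `{γ₀} h17 hsm hγle`)
    (hcoer : ∀ i Vk, PlaqSmallOn (plaqsInside (pts (k i) (Z i ∩ (Λ i)ᶜ))) (eR i) Vk → ∀ X : GaugeSlice (pts (k i) (Λ i)) (T i) E3,
      γ / (M i) ^ 5 * ‖X‖ ^ 2 ≤ ⟪X, (fderiv ℝ (rGrad (pts (k i) (Λ i)) (T i)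
              (sliceFn (pts (k i) (Λ i)) (T i)
                (fun177std (Node00.bgMSCoPOfRecord F 2 ν Kt (k i) (maxDomT ν.M₁ (Z i))) ν.M₁ (Z i) (k i)) (ext i Vk))) 0) X⟫)
    -- the geometric letter: the k-blocks over the bonds meeting `Λ^{(k)}` lie inside `Ω₁(Z)`
    (hfar : ∀ i (b : PBond (F.P Kt) 0), b.src ∉ maxDomT ν.M₁ (Z i) 1 →
      (⟨blockIter (k i) b.src, b.dir⟩ : PBond (F.P Kt) (k i)) ∉ bondsOf (pts (k i) (Λ i)))
    -- (Gᵃ) geometry of `Z`: a union of `k`-blocks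
    (hZblk : ∀ i, IsBlockUnion (k i) (Z i))
    -- print's `M₁ ≥ 2` and the torus divisibility `L^{k}M₁ ∣ 2L^{m+K}`
    (hM2 : 2 ≤ ν.M₁) (hdiv : ∀ i, side (F.P Kt).L ν.M₁ (k i) ∣ (F.P Kt).sitesPerDir 0)
    -- bookkeeping constants
    {cE B₃ a₀ a₁' cA : ℝ} (hcE0 : 0 ≤ cE) (hcE : ∀ i, 12 * ((F.P Kt).d : ℝ) * ((n i : ℝ) + 2) ^ 2 ≤ cE) (hB₃ : 0 ≤ B₃)
    (heRa : ∀ i, (cE + 1) * eR i ≤ a₁' ∧ B₃ * ((cE + 1) * eR i) ≤ ν.εreg) (ha₀ : ν.εreg ≤ a₀)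
    (hcA : 1 / 2 * (B₃ * (cE + 1) * (F.P Kt).eta 1 ^ 2) ^ 2 * (Fintype.card (Plaq (F.P Kt) 0) : ℝ) ≤ cA)
    -- [15] THEOREM 1 (R), CLOSED GENERAL-SEQUENCE FORM, GUARDED, IN NODE 00's TORUS-NATIVE CLASS (shape (C)) — served by K0⁷'s def (n12-d 12Q⁵)
    (h15T : ∀ (k' : ℕ), k' ≤ (F.P Kt).m + (F.P Kt).K → side (F.P Kt).L ν.M₁ k' ∣ (F.P Kt).sitesPerDir 0 →
      ∀ (s : B14.Eq218Concrete.Seq (fun n : ℕ => Node00.unionsOfCubes (F.P Kt) (side (F.P Kt).L ν.M₁ n)) k'),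
      Node00.Sect2.SeqSeparated ν.M₁ s → 0 < ν.M₁ →
      ∀ (ε₀ : ℝ) (δ : ℕ → ℝ), (∀ j, j ≤ k' → 0 < δ j ∧ δ j ≤ a₁' ∧ B₃ * δ j ≤ ε₀) → (∀ j, j < k' → δ j ≤ 2 * δ (j + 1)) →
      (∀ j, j < k' → δ (j + 1) ≤ 2 * δ j) → ε₀ ≤ a₀ →
      ∀ W : MSField (F.P Kt) SU2,
        Node00.Sect2.DataSmall7PTop (Node00.avOfRecord F 2 Kt) s.Ω (Node00.suppDomOfRecord F ν Kt s.Ω) k' δ W →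
        ∀ U₀ : GaugeField (F.P Kt) 0 SU2, IsMinimizer (Node00.avOfRecord F 2 Kt)
            {U | (∀ j, j ≤ k' → PlaqSmallOn (Node00.Sect2.omegaPlaqsTop s.Ω (Node00.suppDomOfRecord F ν Kt s.Ω) j)
                (ε₀ * (F.P Kt).eta j ^ 2) U) ∧
              Node00.Sect2.CoDivClassOnTop s.Ω (Node00.suppDomOfRecord F ν Kt s.Ω) k' ε₀ U}
            (genSet s.Ω k') W U₀ →
          (∀ j, j ≤ k' → PlaqSmallOn (Node00.Sect2.omegaPlaqsTop s.Ω (Node00.suppDomOfRecord F ν Kt s.Ω) j)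
              (B₃ * δ j * (F.P Kt).eta j ^ 2) U₀) ∧
            ∀ j, j ≤ k' → Node00.Sect2.CoDivSmallOn (Node00.Sect2.omegaBondsTop s.Ω (Node00.suppDomOfRecord F ν Kt s.Ω) j)
              (B₃ * δ j * (F.P Kt).eta j ^ 3) U₀)
    : ∃ R : ι → ℝ, (∀ i, 0 < R i) ∧ ∃ a₁ : ι → ℝ, (∀ i, 0 < a₁ i) ∧
      B15.Prop1Printed (lfVarOn su2Chart fun i =>
        InstOn.std (Node00.bgMSCoPOfRecord F 2 ν Kt (k i) (maxDomT ν.M₁ (Z i))) ν.M₁ (Z i) (Λ i) (k i) (M i) (a₁ i)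
          (anExt (pts (k i) (Λ i)) (T i)
            (fun177std (Node00.bgMSCoPOfRecord F 2 ν Kt (k i) (maxDomT ν.M₁ (Z i))) ν.M₁ (Z i) (k i)) (ext i)
            (min (1 / 2) (min (R i / 8) (γ / (M i) ^ 5 * (R i / 2) ^ 2 /
              (48 * (4 * ((Fintype.card (Plaq (F.P Kt) 0) : ℝ) * (1 + 8 * 𝓐₀ i ^ 4)) / R i + 1))))))) := by
  -- the radii, per instance, on the closed guard
  choose R hR hRall using hMinK
  -- the current constant, uniformly over the finite index
  obtain ⟨cJ, hcJ, hcJ'⟩ := exists_forall_le_of_finite fun i =>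
    2 * cA * eR i / R i + 4 * ((Fintype.card (Plaq (F.P Kt) 0) : ℝ) * (1 + 8 * 𝓐₀ i ^ 4)) / (R i * eR i)
  refine ⟨R, hR, ?_⟩
  exact exists_domain_prop1Printed_lfVarOn_std_su2_box_intrinsic_analytic_atZSeqCoPRecord_ofThm1TorusClass_ofMinimiserFamily_ofCoercive ν Kt hd3 h0 hcl
    Z Λ k M hk0 hk eR heR T lo hi n hn hN hbox hZ hTG0 hN5 ext hext hlohi hγ hcJ hbx hbxM hM hR
    (fun i Vk hV => hRall i Vk (plaqLeOn_of_plaqSmallOn hV)) hcoer hfar hZblk hM2 hdiv hcE0 hcE hB₃ heRa ha₀ hcA h15T hcJ'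


/-- ★★★ **PROPOSITION 1 [IV] AT PRINT'S (1.74) OBJECT — COERCIVE ((1.9)-LETTER) EDITION (the `_oneSided` twin with `{γ₀} hγ₀ h17 hsm hγle` ↦ `hcoer`) — FROM THE COMPACTNESS ROUTE'S (J0′).**  §3 with the letter in the SHAPE the w1 lineage
delivers (`B15Prop1MinimiserFamilyPatching.hMin_of_localCharts`, `B15Prop1CriticalChartFromIFT.hMin_of_criticalFamilies`, and their successor from base-field letters):
`hMinC` — for every instance and EVERY COMPACT SET `K` of base fields inside the closed guard, ONE radius `R > 0` with the three clauses for all `V_k ∈ K`.  The closed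
guard is itself compact (§1), so `hMinC` specialises to `hMinK`; a consumer holding the w1 theorem at fixed `𝓐₀ i` writes `fun i K hK _ => <w1 theorem> … hK …`.
[cite: Balaban1989LargeFieldI, (1.74) p.192, Prop. 1 (1.77)–(1.78) p.194 (incl. the last clause), (1.79) p.195; Balaban1989LargeFieldII, (1.7)–(1.9) p.358, (1.12)–(1.13) p.359;
Balaban1985Variational, (7) p.278, Thm 1 (8) p.279, Prop. 9 (190) p.309; Balaban1988Convergent, (2.12)–(2.14) pp.256–257] -/
theorem exists_domain_prop1Printed_lfVarOn_std_su2_box_intrinsic_analytic_atZSeqCoPRecord_ofThm1TorusClass_ofMinimiserFamilyCompact_ofCoercive {F : T4Family}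
    (ν : Node00.Stage7Numerics) (Kt : ℕ) (hd3 : 3 ≤ (F.P Kt).d) (h0 : 0 < (F.P Kt).d) {ι : Type} [Finite ι]
    [hdec : ∀ j, DecidableEq (PBond (F.P Kt) j)] (hcl : hdec = fun _ a b => Classical.propDecidable (a = b))
    (Z Λ : ι → Set (Site (F.P Kt) 0)) (k : ι → ℕ) (M : ι → ℝ) (hk0 : ∀ i, 0 < k i) (hk : ∀ i, k i ≤ (F.P Kt).m + (F.P Kt).K)
    (eR : ι → ℝ) (heR : ∀ i, 0 < eR i)
    (T : ∀ i, Finset (PBond (F.P Kt) (k i)))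
    (lo hi : ι → Fin (F.P Kt).d → ℤ) (n : ι → ℕ) (hn : ∀ i κ, hi i κ ≤ lo i κ + n i) (hN : ∀ i, n i + 2 < (F.P Kt).sitesPerDir (k i))
    (hbox : ∀ i, pts (k i) (Λ i) = (castSite '' Set.Icc (lo i) (hi i) : Set (Site (F.P Kt) (k i))))
    (hZ : ∀ i, (boxPlaqs (lo i - 1) (hi i + 1) : Set (Plaq (F.P Kt) (k i))) ⊆ plaqsInside (pts (k i) (Z i)))
    (hTG0 : ∀ i, T i = (box (fun κ => (hi i κ - lo i κ + 1).toNat) (lo i)).image fun x =>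
      (⟨castSite (x - unitVec ⟨0, h0⟩), ⟨0, h0⟩⟩ : PBond (F.P Kt) (k i)))
    (hN5 : ∀ i κ, ((hi i κ - lo i κ + 1).toNat : ℤ) + 5 < (F.P Kt).sitesPerDir (k i))
    (ext : ∀ i, GaugeField (F.P Kt) (k i) SU2 → GaugeField (F.P Kt) (k i) SU2)
    (hext : ∀ i Vk, ext i Vk = extend (pts (k i) (Λ i)) (shellGauge Vk (lo i) (hi i)) Vk)
    (hlohi : ∀ i, lo i ≤ hi i)
    {γ bx : ℝ} (hγ : 0 < γ) (hbx : 0 ≤ bx)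
    (hbxM : ∀ i, 12 * ((F.P Kt).d : ℝ) * ((n i : ℝ) + 2) ^ 2 ≤ bx * (M i) ^ 2)
    {𝓐₀ : ι → ℝ} (hM : ∀ i, 1 ≤ (M i))
    -- (J0′) IN THE COMPACTNESS ROUTE'S SHAPE: for every compact set of base fields inside the closed guard, ONE radius
    (hMinC : ∀ i (K : Set (GaugeField (F.P Kt) (k i) SU2)), IsCompact K →
      (∀ Vk ∈ K, ∀ p ∈ plaqsInside (pts (k i) (Z i ∩ (Λ i)ᶜ)), dist1 (GaugeField.plaqHol Vk p) ≤ eR i) →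
      ∃ R : ℝ, 0 < R ∧ ∀ Vk ∈ K,
      ∃ Ũ : VecField (F.P Kt) (k i) (EuclideanSpace ℂ (Fin 3)) × VecField (F.P Kt) (k i) (EuclideanSpace ℂ (Fin 3)) →
          PBond (F.P Kt) 0 → Matrix (Fin 2) (Fin 2) ℂ,
        (∀ b a c, DifferentiableOn ℂ (fun z => Ũ z b a c) (ball 0 R)) ∧
        (∀ z ∈ ball (0 : VecField (F.P Kt) (k i) (EuclideanSpace ℂ (Fin 3)) × VecField (F.P Kt) (k i) (EuclideanSpace ℂ (Fin 3))) R,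
          ∀ b a c, ‖Ũ z b a c‖ ≤ 𝓐₀ i) ∧
        ∀ p B' : VecField (F.P Kt) (k i) E3, ‖p‖ < R → ‖B'‖ < R → ∃ U' : GaugeField (F.P Kt) 0 SU2,
          (∀ b, Ũ (cplxVec p, cplxVec B') b = ((U' b : SU2) : Matrix (Fin 2) (Fin 2) ℂ)) ∧
            IsMinimizer (Node00.avOfRecord F 2 Kt) (Node00.regMSCoPOfRecord F 2 ν Kt (k i) (maxDomT ν.M₁ (Z i))) (Bj ν.M₁ (Z i) (k i))
              (avgFamily (Node00.avOfRecord F 2 Kt) (qsstarGIter0 (k i) (expMul su2Chart B' (ext i (expMul su2Chart p Vk))))) U')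
    -- (L2) one-sided, γ₀-generic
    -- (L2) = (1.9) p.358 AS THE LETTER: coercivity of the slice Hessian `D(∇ sliceFn)(0)` at `eR`-regular data (dag-n12-c's `hcoer`; replaces `{γ₀} h17 hsm hγle`)
    (hcoer : ∀ i Vk, PlaqSmallOn (plaqsInside (pts (k i) (Z i ∩ (Λ i)ᶜ))) (eR i) Vk → ∀ X : GaugeSlice (pts (k i) (Λ i)) (T i) E3,
      γ / (M i) ^ 5 * ‖X‖ ^ 2 ≤ ⟪X, (fderiv ℝ (rGrad (pts (k i) (Λ i)) (T i)
              (sliceFn (pts (k i) (Λ i)) (T i)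
                (fun177std (Node00.bgMSCoPOfRecord F 2 ν Kt (k i) (maxDomT ν.M₁ (Z i))) ν.M₁ (Z i) (k i)) (ext i Vk))) 0) X⟫)
    (hfar : ∀ i (b : PBond (F.P Kt) 0), b.src ∉ maxDomT ν.M₁ (Z i) 1 →
      (⟨blockIter (k i) b.src, b.dir⟩ : PBond (F.P Kt) (k i)) ∉ bondsOf (pts (k i) (Λ i)))
    (hZblk : ∀ i, IsBlockUnion (k i) (Z i))
    (hM2 : 2 ≤ ν.M₁) (hdiv : ∀ i, side (F.P Kt).L ν.M₁ (k i) ∣ (F.P Kt).sitesPerDir 0)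
    {cE B₃ a₀ a₁' cA : ℝ} (hcE0 : 0 ≤ cE) (hcE : ∀ i, 12 * ((F.P Kt).d : ℝ) * ((n i : ℝ) + 2) ^ 2 ≤ cE) (hB₃ : 0 ≤ B₃)
    (heRa : ∀ i, (cE + 1) * eR i ≤ a₁' ∧ B₃ * ((cE + 1) * eR i) ≤ ν.εreg) (ha₀ : ν.εreg ≤ a₀)
    (hcA : 1 / 2 * (B₃ * (cE + 1) * (F.P Kt).eta 1 ^ 2) ^ 2 * (Fintype.card (Plaq (F.P Kt) 0) : ℝ) ≤ cA)
    (h15T : ∀ (k' : ℕ), k' ≤ (F.P Kt).m + (F.P Kt).K → side (F.P Kt).L ν.M₁ k' ∣ (F.P Kt).sitesPerDir 0 →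
      ∀ (s : B14.Eq218Concrete.Seq (fun n : ℕ => Node00.unionsOfCubes (F.P Kt) (side (F.P Kt).L ν.M₁ n)) k'),
      Node00.Sect2.SeqSeparated ν.M₁ s → 0 < ν.M₁ →
      ∀ (ε₀ : ℝ) (δ : ℕ → ℝ), (∀ j, j ≤ k' → 0 < δ j ∧ δ j ≤ a₁' ∧ B₃ * δ j ≤ ε₀) → (∀ j, j < k' → δ j ≤ 2 * δ (j + 1)) →
      (∀ j, j < k' → δ (j + 1) ≤ 2 * δ j) → ε₀ ≤ a₀ →
      ∀ W : MSField (F.P Kt) SU2,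
        Node00.Sect2.DataSmall7PTop (Node00.avOfRecord F 2 Kt) s.Ω (Node00.suppDomOfRecord F ν Kt s.Ω) k' δ W →
        ∀ U₀ : GaugeField (F.P Kt) 0 SU2, IsMinimizer (Node00.avOfRecord F 2 Kt)
            {U | (∀ j, j ≤ k' → PlaqSmallOn (Node00.Sect2.omegaPlaqsTop s.Ω (Node00.suppDomOfRecord F ν Kt s.Ω) j)
                (ε₀ * (F.P Kt).eta j ^ 2) U) ∧
              Node00.Sect2.CoDivClassOnTop s.Ω (Node00.suppDomOfRecord F ν Kt s.Ω) k' ε₀ U}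
            (genSet s.Ω k') W U₀ →
          (∀ j, j ≤ k' → PlaqSmallOn (Node00.Sect2.omegaPlaqsTop s.Ω (Node00.suppDomOfRecord F ν Kt s.Ω) j)
              (B₃ * δ j * (F.P Kt).eta j ^ 2) U₀) ∧
            ∀ j, j ≤ k' → Node00.Sect2.CoDivSmallOn (Node00.Sect2.omegaBondsTop s.Ω (Node00.suppDomOfRecord F ν Kt s.Ω) j)
              (B₃ * δ j * (F.P Kt).eta j ^ 3) U₀)
    : ∃ R : ι → ℝ, (∀ i, 0 < R i) ∧ ∃ a₁ : ι → ℝ, (∀ i, 0 < a₁ i) ∧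
      B15.Prop1Printed (lfVarOn su2Chart fun i =>
        InstOn.std (Node00.bgMSCoPOfRecord F 2 ν Kt (k i) (maxDomT ν.M₁ (Z i))) ν.M₁ (Z i) (Λ i) (k i) (M i) (a₁ i)
          (anExt (pts (k i) (Λ i)) (T i)
            (fun177std (Node00.bgMSCoPOfRecord F 2 ν Kt (k i) (maxDomT ν.M₁ (Z i))) ν.M₁ (Z i) (k i)) (ext i)
            (min (1 / 2) (min (R i / 8) (γ / (M i) ^ 5 * (R i / 2) ^ 2 /
              (48 * (4 * ((Fintype.card (Plaq (F.P Kt) 0) : ℝ) * (1 + 8 * 𝓐₀ i ^ 4)) / R i + 1))))))) :=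
  exists_domain_prop1Printed_lfVarOn_std_su2_box_intrinsic_analytic_atZSeqCoPRecord_ofThm1TorusClass_ofMinimiserFamilyUniform_ofCoercive ν Kt hd3 h0 hcl
    Z Λ k M hk0 hk eR heR T lo hi n hn hN hbox hZ hTG0 hN5 ext hext hlohi hγ hbx hbxM hM
    (fun i => forall_of_forall_isCompact_subset (plaqsInside (pts (k i) (Z i ∩ (Λ i)ᶜ))) (eR i) (fun R Vk =>
      ∃ Ũ : VecField (F.P Kt) (k i) (EuclideanSpace ℂ (Fin 3)) × VecField (F.P Kt) (k i) (EuclideanSpace ℂ (Fin 3)) →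
          PBond (F.P Kt) 0 → Matrix (Fin 2) (Fin 2) ℂ,
        (∀ b a c, DifferentiableOn ℂ (fun z => Ũ z b a c) (ball 0 R)) ∧
        (∀ z ∈ ball (0 : VecField (F.P Kt) (k i) (EuclideanSpace ℂ (Fin 3)) × VecField (F.P Kt) (k i) (EuclideanSpace ℂ (Fin 3))) R,
          ∀ b a c, ‖Ũ z b a c‖ ≤ 𝓐₀ i) ∧
        ∀ p B' : VecField (F.P Kt) (k i) E3, ‖p‖ < R → ‖B'‖ < R → ∃ U' : GaugeField (F.P Kt) 0 SU2,
          (∀ b, Ũ (cplxVec p, cplxVec B') b = ((U' b : SU2) : Matrix (Fin 2) (Fin 2) ℂ)) ∧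
            IsMinimizer (Node00.avOfRecord F 2 Kt) (Node00.regMSCoPOfRecord F 2 ν Kt (k i) (maxDomT ν.M₁ (Z i))) (Bj ν.M₁ (Z i) (k i))
              (avgFamily (Node00.avOfRecord F 2 Kt) (qsstarGIter0 (k i) (expMul su2Chart B' (ext i (expMul su2Chart p Vk))))) U')
      (hMinC i))
    hcoer hfar hZblk hM2 hdiv hcE0 hcE hB₃ heRa ha₀ hcA h15T

end Compact

end Literature.MathematicalPhysics.QuantumFieldTheory.Balaban1983to89.B15Prop1CoerciveEdition

end
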